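import Literature.Analysis.FluidPDE.PlanarVorticityEntropy
import Literature.Analysis.FluidPDE.PlanarVorticityLpDecay
import Literature.Analysis.FluidPDE.RadialCalculus
import HarnessLib

/-!
# Gallay–Wayne's entropy relaxation of a NON-NEGATIVE planar vorticity to the Oseen vortex:
# the positivity / log-tameness hypotheses of `PlanarVorticityEntropy` removed

Literature file (topic `Analysis/FluidPDE`), theorems only: no definitions, no named facts.
The printed statements (Th. Gallay, C. E. Wayne, *Global stability of vortex solutions of the
two-dimensional Navier–Stokes equation*, Comm. Math. Phys. 255 (2005) 97–129 =
arXiv:math/0402449; held text pp. 11–12, 14), in the self-similar variables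
`ξ = x/√(νt)`, `τ = log t`, `ω(x,t) = t⁻¹ w(ξ, τ)`, `G(ξ) = (4π)⁻¹ e^{-|ξ|²/4}`:

* **Lemma 3.2** (p. 11): for a NON-NEGATIVE solution (`w₀ ∈ L²(m)`, `w₀ ≥ 0`, `∫ w₀ = α > 0`) the
  relative entropy `H(w(τ)) = ∫ w log (w/G)` is non-increasing in `τ`;
* **§3.4 "Convergence rate for positive solutions"** (p. 14): `H(w(τ)) − H(αG) ≤
  (H(w₀) − H(αG)) e^{−τ}` (Stam–Gross logarithmic Sobolev inequality) and
  `‖w(τ) − αG‖_{L¹} ≤ √(2α) (H(w₀) − H(αG))^{1/2} e^{−τ/2}` (Csiszár–Kullback).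

The companion file `PlanarVorticityEntropy` typed these in PHYSICAL variables for the class of
POSITIVE, LOG-TAME vorticities (`0 < ω`, `|log ω| ≤ L(1+‖x‖)^k`, `‖∇ω‖ ≤ L(1+‖x‖)^k ω` at all
times — Gallay–Wayne's intermediate step, which they justify by Gaussian lower bounds of
Osada / Carlen–Loss type). THIS file proves the same three conclusions for every NON-NEGATIVE
datum `ω(t₀) ≥ 0` of a classical planar solution in the tree's uniform rapid-decay class — the
printed hypothesis of Lemma 3.2 — with NO positivity, log-tameness or log-Lipschitz assumption at
any time:

* `IsClassicalNSSolutionOn.relEntropy_mul_le_of_nonneg` — **§3.4, first display**: on a convex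
  time set `S`, curl-free force, `u = K₂ ∗ ω`, uniform rapid decay of `ω`, `ω(t₀) ≥ 0`,
  `Γ = ∫ ω(t₀) > 0`, `t⋆ > 0`, `T(s) = s − t₀ + t⋆`, `g_s = Γ(4πνT(s))⁻¹e^{−‖x‖²/(4νT(s))}`: for
  `t₀ ≤ t` in `S`, `H(t)·T(t) ≤ H(t₀)·t⋆` where `H(s) = ∫ ω(s) log(ω(s)/g_s)` (`0 log 0 = 0`);
* `IsClassicalNSSolutionOn.relEntropy_le_of_nonneg` — **Lemma 3.2 as printed**: `H(t) ≤ H(t₀)`;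
* `IsClassicalNSSolutionOn.integral_abs_planarVorticity_sub_gaussian_le_of_nonneg` — **§3.4,
  second display**: `∫ |ω(t) − g_t| ≤ √(2 Γ H(t₀) t⋆ / T(t))`;
(and, privately, the splitting `∫ w log(w/g) = ∫ w log w + (∫‖x‖²w)/(4νT) + log(4πνT/Γ) ∫ w`
without sign condition, Lean's `0 log 0 = 0`).

## Method (where we deviate from the printed road)

Gallay–Wayne make `log w` tame by the Gaussian lower bound of the fundamental solution of
`∂_τ − L − v·∇` (Osada 1987), which the tree does not have. Instead we REGULARISE: for
`0 < ε ≤ 1` put `θ_ε(s) = ω(s) + ε η`, `η(x) = ((1 + ‖x‖²)³)⁻¹` (§0: `‖∇η‖ ≤ 6η`, `|Δη| ≤ 60η`,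
`|D²η(e,e)| ≤ 54η`, `log η ≥ −6‖x‖`). Then `θ_ε > 0`, `|log θ_ε + 1| ≤ (log(C+1) + |log ε| + 7)(1+‖x‖)`
and `‖∇θ_ε‖²/θ_ε ≤ ‖∇θ_ε‖²/(εη) ∈ L¹` (§1), so Gallay–Wayne's computation goes through for `θ_ε`
EXACTLY, the vorticity equation contributing the two `εη`-corrections
`ε ∫ (log θ_ε + 1)(∇η·u − νΔη) = O(ε log(1/ε))` (§2 fixed-time balance
`∫ (log θ_ε + 1) ∂ₜω = −ν ∫ ‖∇θ_ε‖²/θ_ε + ε R_ε`; §3 the entropy law within a convex set of times by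
dominated differentiation). With the moment laws `dΓ/dt = 0`, `d/dt ∫‖x‖²ω = 4νΓ`
(`PlanarVorticityMoments`) and the Stam–Gross inequality for the POSITIVE function `θ_ε(s)`
(`Literature.Analysis.FunctionSpaces.integral_mul_log_le_fisher`, mass `Γ + ε∫η`, `τ = νT(s)`)
one gets `d/ds (H_ε·T) ≤ ε T |R_ε| − ε ∫ η ≤ κ_ε`, i.e. `H_ε(t)T(t) ≤ H_ε(t₀)t⋆ + κ_ε (t − t₀)` with
`κ_ε = ε (log(C+1) + |log ε| + 7)(6M + 60|ν|)(8∫(1+‖x‖)^{-5}) T(t)` (§4). Finally `ε → 0⁺` (§5):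
`H_ε(s) → H(s)` by dominated convergence with `|θ log θ| ≤ 2√θ + θ²`, and `κ_ε → 0`
(`tendsto_log_mul_rpow_nhdsGT_zero`). The only dynamical inputs are the tree's vorticity equation
(MB (2.6)), the minimum principle `integral_abs_planarVorticity_eq_of_nonneg` (`ω(s) ≥ 0` and
`‖ω(s)‖₁ = Γ` for `s ≥ t₀`) and the Biot–Savart sup bound `norm_biotSavart2D_le` (a uniform
velocity bound `(2π)⁻¹(C·I₁ + Γ)` on `[t₀, t]`).

What is NOT here: sign-changing data (Gallay–Wayne: "we do not know how to extend the entropy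
dissipation method to the general case" — their general `L¹` convergence, Prop. 3.4/Thm. 1.2, has no
rate); the self-similar change of variables; the EXACT dissipation identity `dH/dt = −νI_rel` in
the limit (only the inequality survives `ε → 0` here; the identity for the positive log-tame class
is `PlanarVorticityEntropy`); existence. TODO(general form): Gaussian centred at the conserved
centre of vorticity `x_c ≠ 0`.

HONEST FRAMING (cell `ns-blowup`, bears_on LADDER-NS N1 crux `HeredityFromTwoT` / standing record
`HeredityFromTwo`, MODEL lane «child core = Lundgren cross-section»): identities and a-priori bounds
of PLANAR viscous vorticity dynamics, used in the cell only through Lundgren's transformation as a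
relaxation clock of a stretched tube's CO-SIGNED cross-section towards the Burgers vortex. Nothing
here asserts anything about Navier–Stokes regularity or blow-up in 3-D.

## References

* [GallayWayne2005] Th. Gallay, C. E. Wayne, Comm. Math. Phys. 255 (2005) 97–129 =
  arXiv:math/0402449 — Lemma 3.2 (p. 11), its proof (p. 12), §3.4 (p. 14). READ (held text).
* [MajdaBertozziCUP2002] A. J. Majda, A. L. Bertozzi, *Vorticity and Incompressible Flow*, CUP
  2002 — §1.7 Prop. 1.14 (moments), §2.1 (2.6) (vorticity equation).
* [BakryGentilLedoux2014] D. Bakry, I. Gentil, M. Ledoux, Springer 2014 — Prop. 6.2.5 (the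
  logarithmic Sobolev inequality; tree `EuclideanLogSobolevDecay`).
* [BoucheronLugosiMassart2013] S. Boucheron, G. Lugosi, P. Massart, OUP 2013 — Thm. 4.19 (Pinsker;
  tree `CsiszarKullbackPinsker`).
-/

noncomputable section

open MeasureTheory Set Function Filter InnerProductSpace
open _root_.Topology
open scoped ContDiff Laplacian RealInnerProductSpace Topology

namespace Literature.Analysis.FluidPDE

/-! ### §0 Weights, and the algebraic regularising weight `η(x) = (1 + ‖x‖²)⁻³` -/

section Weights

variable {X : Type*} [SeminormedAddCommGroup X]

/-- Weight algebra: `(1 + ‖x‖)^a · (1 + ‖x‖)^{-(a + m)} = (1 + ‖x‖)^{-m}`. [folklore] -/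
private theorem pow_mul_rpow_neg_add' (x : X) (a m : ℕ) :
    (1 + ‖x‖) ^ a * (1 + ‖x‖) ^ (-((a + m : ℕ) : ℝ)) = (1 + ‖x‖) ^ (-(m : ℝ)) := by
  have hx : (0 : ℝ) < 1 + ‖x‖ := by positivity
  rw [← Real.rpow_natCast, ← Real.rpow_add hx]
  congr 1
  push_cast
  ring

/-- `1 ≤ (1 + ‖x‖)^a`. [folklore] -/
private theorem one_le_pow_one_add_norm' (x : X) (a : ℕ) : (1 : ℝ) ≤ (1 + ‖x‖) ^ a :=
  one_le_pow₀ (by linarith [norm_nonneg x])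

end Weights

section Eta

/-! The weight `η(x) = ((1 + ‖x‖²)³)⁻¹` on `ℝ²`: positivity, size, derivative, Laplacian. We do not
introduce a definition; every statement is about the explicit function. -/

/-- `((1+s)^{k+1})⁻¹ t ≤ ((1+s)^k)⁻¹` for `0 ≤ t ≤ 1 + s`. [folklore] -/
private theorem inv_pow_succ_mul_le {s t : ℝ} (hs : 0 < 1 + s) (ht : t ≤ 1 + s)
    (k : ℕ) : ((1 + s) ^ (k + 1))⁻¹ * t ≤ ((1 + s) ^ k)⁻¹ := by
  rw [pow_succ, mul_inv, mul_assoc]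
  refine mul_le_of_le_one_right (by positivity) ?_
  rw [← div_eq_inv_mul, div_le_one hs]
  exact ht

/-- The radial profile `g(σ) = ((1 + σ)³)⁻¹` has derivative `−3 ((1 + σ)⁴)⁻¹` at `σ > −1`.
[folklore] -/
private theorem hasDerivAt_inv_cube {σ : ℝ} (hσ : 0 < 1 + σ) :
    HasDerivAt (fun s : ℝ => ((1 + s) ^ 3)⁻¹) (-3 * ((1 + σ) ^ 4)⁻¹) σ := by
  have h1 : HasDerivAt (fun s : ℝ => (1 + s) ^ 3) ((3 : ℕ) * (1 + σ) ^ (3 - 1) * 1) σ :=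
    ((hasDerivAt_id σ).const_add 1).pow 3
  have h2 := h1.inv (pow_ne_zero 3 hσ.ne')
  refine h2.congr_deriv ?_
  have h4 : (1 + σ) ^ 4 ≠ 0 := pow_ne_zero 4 hσ.ne'
  have h6 : ((1 + σ) ^ 3) ^ 2 ≠ 0 := pow_ne_zero 2 (pow_ne_zero 3 hσ.ne')
  field_simp
  ring

/-- The derivative profile `g₁(σ) = −3 ((1 + σ)⁴)⁻¹` has derivative `12 ((1 + σ)⁵)⁻¹` at
`σ > −1`. [folklore] -/
private theorem hasDerivAt_inv_fourth {σ : ℝ} (hσ : 0 < 1 + σ) :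
    HasDerivAt (fun s : ℝ => -3 * ((1 + s) ^ 4)⁻¹) (12 * ((1 + σ) ^ 5)⁻¹) σ := by
  have h1 : HasDerivAt (fun s : ℝ => (1 + s) ^ 4) ((4 : ℕ) * (1 + σ) ^ (4 - 1) * 1) σ :=
    ((hasDerivAt_id σ).const_add 1).pow 4
  have h2 := (h1.inv (pow_ne_zero 4 hσ.ne')).const_mul (-3)
  refine h2.congr_deriv ?_
  have h5 : (1 + σ) ^ 5 ≠ 0 := pow_ne_zero 5 hσ.ne'
  have h8 : ((1 + σ) ^ 4) ^ 2 ≠ 0 := pow_ne_zero 2 (pow_ne_zero 4 hσ.ne')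
  field_simp
  ring

/-- `0 < η(x) ≤ 1`. [folklore] -/
private theorem eta_pos_le_one (x : EuclideanSpace ℝ (Fin 2)) :
    0 < (((1 : ℝ) + ‖x‖ ^ 2) ^ 3)⁻¹ ∧ (((1 : ℝ) + ‖x‖ ^ 2) ^ 3)⁻¹ ≤ 1 := by
  have h1 : (0 : ℝ) < 1 + ‖x‖ ^ 2 := by positivity
  refine ⟨by positivity, inv_le_one_of_one_le₀ (one_le_pow₀ (by nlinarith [norm_nonneg x]))⟩

/-- `η(x) ≤ 8 (1 + ‖x‖)^{-6}`. [folklore] -/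
private theorem eta_le_rpow (x : EuclideanSpace ℝ (Fin 2)) :
    (((1 : ℝ) + ‖x‖ ^ 2) ^ 3)⁻¹ ≤ 8 * (1 + ‖x‖) ^ (-(6 : ℝ)) := by
  have h0 : (0 : ℝ) < 1 + ‖x‖ := by positivity
  have h1 : (0 : ℝ) < 1 + ‖x‖ ^ 2 := by positivity
  have key : (1 + ‖x‖) ^ 6 ≤ 8 * (1 + ‖x‖ ^ 2) ^ 3 := by
    have h : (1 + ‖x‖) ^ 2 ≤ 2 * (1 + ‖x‖ ^ 2) := by nlinarith [norm_nonneg x, sq_nonneg (1 - ‖x‖)]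
    calc (1 + ‖x‖) ^ 6 = ((1 + ‖x‖) ^ 2) ^ 3 := by ring
      _ ≤ (2 * (1 + ‖x‖ ^ 2)) ^ 3 := pow_le_pow_left₀ (sq_nonneg _) h 3
      _ = 8 * (1 + ‖x‖ ^ 2) ^ 3 := by ring
  rw [show (-(6 : ℝ)) = -((6 : ℕ) : ℝ) by norm_num, Real.rpow_neg h0.le, Real.rpow_natCast]
  calc (((1 : ℝ) + ‖x‖ ^ 2) ^ 3)⁻¹ = 8 / (8 * (1 + ‖x‖ ^ 2) ^ 3) := by field_simp
    _ ≤ 8 / (1 + ‖x‖) ^ 6 := div_le_div_of_nonneg_left (by norm_num) (by positivity) key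
    _ = 8 * ((1 + ‖x‖) ^ 6)⁻¹ := div_eq_mul_inv _ _

/-- `η(x) ≤ 8 (1 + ‖x‖)^{-N}` for `N ≤ 6`. [folklore] -/
private theorem eta_le_rpow_of_le (x : EuclideanSpace ℝ (Fin 2)) {N : ℝ} (hN : N ≤ 6) :
    (((1 : ℝ) + ‖x‖ ^ 2) ^ 3)⁻¹ ≤ 8 * (1 + ‖x‖) ^ (-N) :=
  (eta_le_rpow x).trans (mul_le_mul_of_nonneg_left (rpow_neg_le_rpow_neg_of_le x hN) (by norm_num))

/-- `η` is smooth. [folklore] -/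
private theorem contDiff_eta :
    ContDiff ℝ ∞ (fun x : EuclideanSpace ℝ (Fin 2) => (((1 : ℝ) + ‖x‖ ^ 2) ^ 3)⁻¹) := by
  have h1 : ContDiff ℝ ∞ (fun x : EuclideanSpace ℝ (Fin 2) => (1 : ℝ) + ‖x‖ ^ 2) :=
    contDiff_const.add (contDiff_norm_sq ℝ)
  exact (h1.pow 3).inv fun x => by positivity

/-- The derivative of `η`: `Dη(x) a = −6 ((1 + ‖x‖²)⁴)⁻¹ ⟪x, a⟫`. [folklore] -/
private theorem fderiv_eta_apply (x a : EuclideanSpace ℝ (Fin 2)) :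
    fderiv ℝ (fun w : EuclideanSpace ℝ (Fin 2) => (((1 : ℝ) + ‖w‖ ^ 2) ^ 3)⁻¹) x a =
      -6 * ((1 + ‖x‖ ^ 2) ^ 4)⁻¹ * ⟪x, a⟫ := by
  have hσ : (0 : ℝ) < 1 + ‖x‖ ^ 2 := by positivity
  rw [fderiv_comp_norm_sq_apply (g := fun s : ℝ => ((1 + s) ^ 3)⁻¹) (hasDerivAt_inv_cube hσ) a]
  ring

/-- `‖Dη(x)‖ ≤ 6 η(x)`. [folklore] -/
private theorem norm_fderiv_eta_le (x : EuclideanSpace ℝ (Fin 2)) :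
    ‖fderiv ℝ (fun w : EuclideanSpace ℝ (Fin 2) => (((1 : ℝ) + ‖w‖ ^ 2) ^ 3)⁻¹) x‖ ≤
      6 * (((1 : ℝ) + ‖x‖ ^ 2) ^ 3)⁻¹ := by
  have hσ : (0 : ℝ) < 1 + ‖x‖ ^ 2 := by positivity
  have hi : (0 : ℝ) ≤ ((1 + ‖x‖ ^ 2) ^ 4)⁻¹ := by positivity
  refine ContinuousLinearMap.opNorm_le_bound _ (by positivity) fun a => ?_
  rw [fderiv_eta_apply, Real.norm_eq_abs, abs_mul, abs_mul, abs_of_nonneg hi,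
    show |(-6 : ℝ)| = 6 by norm_num]
  have hxa : |⟪x, a⟫| ≤ ‖x‖ * ‖a‖ := abs_real_inner_le_norm x a
  have hx1 : ((1 + ‖x‖ ^ 2) ^ (3 + 1))⁻¹ * ‖x‖ ≤ ((1 + ‖x‖ ^ 2) ^ 3)⁻¹ :=
    inv_pow_succ_mul_le hσ (by nlinarith [norm_nonneg x]) 3
  calc 6 * ((1 + ‖x‖ ^ 2) ^ 4)⁻¹ * |⟪x, a⟫| ≤ 6 * ((1 + ‖x‖ ^ 2) ^ 4)⁻¹ * (‖x‖ * ‖a‖) := by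
        gcongr
    _ = 6 * (((1 + ‖x‖ ^ 2) ^ (3 + 1))⁻¹ * ‖x‖) * ‖a‖ := by ring
    _ ≤ 6 * ((1 + ‖x‖ ^ 2) ^ 3)⁻¹ * ‖a‖ := by gcongr

/-- The radial-calculus data of `η`: `g' = g₁` on `(−1, ∞) ∋ ‖x‖²` and `g₁' = g₂`. [folklore] -/
private theorem eta_profile_data (x : EuclideanSpace ℝ (Fin 2)) :
    IsOpen (Ioi (-1 : ℝ)) ∧
      (∀ σ ∈ Ioi (-1 : ℝ), HasDerivAt (fun s : ℝ => ((1 + s) ^ 3)⁻¹) (-3 * ((1 + σ) ^ 4)⁻¹) σ) ∧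
      ‖x‖ ^ 2 ∈ Ioi (-1 : ℝ) ∧
      HasDerivAt (fun s : ℝ => -3 * ((1 + s) ^ 4)⁻¹) (12 * ((1 + ‖x‖ ^ 2) ^ 5)⁻¹) (‖x‖ ^ 2) := by
  have hσ : (0 : ℝ) < 1 + ‖x‖ ^ 2 := by positivity
  refine ⟨isOpen_Ioi, fun σ hσ' => hasDerivAt_inv_cube (by simpa using neg_lt_iff_pos_add'.1 hσ'),
    ?_, hasDerivAt_inv_fourth hσ⟩
  simp only [mem_Ioi]; nlinarith [norm_nonneg x]

/-- The second derivative entries of `η`: `D²η(x)(a, c) = 48 ((1+‖x‖²)⁵)⁻¹ ⟪x,a⟫⟪x,c⟫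
− 6 ((1+‖x‖²)⁴)⁻¹ ⟪a,c⟫`. [folklore] -/
private theorem fderiv_fderiv_eta_apply (x a c : EuclideanSpace ℝ (Fin 2)) :
    fderiv ℝ (fderiv ℝ (fun w : EuclideanSpace ℝ (Fin 2) => (((1 : ℝ) + ‖w‖ ^ 2) ^ 3)⁻¹)) x a c =
      48 * ((1 + ‖x‖ ^ 2) ^ 5)⁻¹ * ⟪x, a⟫ * ⟪x, c⟫ - 6 * ((1 + ‖x‖ ^ 2) ^ 4)⁻¹ * ⟪a, c⟫ := by
  obtain ⟨hU, hg, hz, hg₁⟩ := eta_profile_data x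
  have hDd : DifferentiableAt ℝ
      (fderiv ℝ (fun w : EuclideanSpace ℝ (Fin 2) => (((1 : ℝ) + ‖w‖ ^ 2) ^ 3)⁻¹)) x :=
    (hasFDerivAt_fderiv_comp_norm_sq hU hg hz hg₁).differentiableAt
  have key := fderiv_fderiv_comp_norm_sq_apply hU hg hz hg₁ c a
  rw [fderiv_clm_apply hDd (differentiableAt_const _)] at key
  simp at key
  rw [key, real_inner_comm a c]
  ring

/-- The Laplacian of `η`: `Δη(x) = 48 ‖x‖² ((1+‖x‖²)⁵)⁻¹ − 12 ((1+‖x‖²)⁴)⁻¹`. [folklore] -/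
private theorem laplacian_eta (x : EuclideanSpace ℝ (Fin 2)) :
    (Δ (fun w : EuclideanSpace ℝ (Fin 2) => (((1 : ℝ) + ‖w‖ ^ 2) ^ 3)⁻¹)) x =
      48 * ‖x‖ ^ 2 * ((1 + ‖x‖ ^ 2) ^ 5)⁻¹ - 12 * ((1 + ‖x‖ ^ 2) ^ 4)⁻¹ := by
  obtain ⟨hU, hg, hz, hg₁⟩ := eta_profile_data x
  rw [laplacian_comp_norm_sq hU hg hz hg₁, finrank_euclideanSpace_fin]
  push_cast
  ring

/-- `|Δη(x)| ≤ 60 η(x)`. [folklore] -/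
private theorem abs_laplacian_eta_le (x : EuclideanSpace ℝ (Fin 2)) :
    |(Δ (fun w : EuclideanSpace ℝ (Fin 2) => (((1 : ℝ) + ‖w‖ ^ 2) ^ 3)⁻¹)) x| ≤
      60 * (((1 : ℝ) + ‖x‖ ^ 2) ^ 3)⁻¹ := by
  have hσ : (0 : ℝ) < 1 + ‖x‖ ^ 2 := by positivity
  have h54 : ((1 + ‖x‖ ^ 2) ^ (4 + 1))⁻¹ * ‖x‖ ^ 2 ≤ ((1 + ‖x‖ ^ 2) ^ 4)⁻¹ :=
    inv_pow_succ_mul_le hσ (by linarith) 4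
  have h43 : ((1 + ‖x‖ ^ 2) ^ (3 + 1))⁻¹ * 1 ≤ ((1 + ‖x‖ ^ 2) ^ 3)⁻¹ :=
    inv_pow_succ_mul_le hσ (by nlinarith [norm_nonneg x]) 3
  rw [mul_one] at h43
  rw [laplacian_eta]
  refine (abs_sub _ _).trans ?_
  rw [abs_of_nonneg (by positivity), abs_of_nonneg (by positivity)]
  have e1 : 48 * ‖x‖ ^ 2 * ((1 + ‖x‖ ^ 2) ^ 5)⁻¹ = 48 * (((1 + ‖x‖ ^ 2) ^ (4 + 1))⁻¹ * ‖x‖ ^ 2) := by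
    ring
  rw [e1]
  have h4 : ((1 + ‖x‖ ^ 2) ^ 4)⁻¹ ≤ (((1 : ℝ) + ‖x‖ ^ 2) ^ 3)⁻¹ := h43
  linarith

/-- `|D²η(x)(e, e)| ≤ 54 η(x)` for unit vectors `e`. [folklore] -/
private theorem abs_fderiv_fderiv_eta_apply_le (x : EuclideanSpace ℝ (Fin 2))
    {e : EuclideanSpace ℝ (Fin 2)} (he : ‖e‖ = 1) :
    |fderiv ℝ (fderiv ℝ (fun w : EuclideanSpace ℝ (Fin 2) => (((1 : ℝ) + ‖w‖ ^ 2) ^ 3)⁻¹)) x e e| ≤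
      54 * (((1 : ℝ) + ‖x‖ ^ 2) ^ 3)⁻¹ := by
  have hσ : (0 : ℝ) < 1 + ‖x‖ ^ 2 := by positivity
  have hi5 : (0 : ℝ) ≤ ((1 + ‖x‖ ^ 2) ^ 5)⁻¹ := by positivity
  have h54 : ((1 + ‖x‖ ^ 2) ^ (4 + 1))⁻¹ * ‖x‖ ^ 2 ≤ ((1 + ‖x‖ ^ 2) ^ 4)⁻¹ :=
    inv_pow_succ_mul_le hσ (by linarith) 4
  have h43 : ((1 + ‖x‖ ^ 2) ^ (3 + 1))⁻¹ * 1 ≤ ((1 + ‖x‖ ^ 2) ^ 3)⁻¹ :=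
    inv_pow_succ_mul_le hσ (by nlinarith [norm_nonneg x]) 3
  rw [mul_one] at h43
  have hxe : ⟪x, e⟫ * ⟪x, e⟫ ≤ ‖x‖ ^ 2 := by
    have h := abs_real_inner_le_norm x e
    rw [he, mul_one] at h
    nlinarith [abs_nonneg ⟪x, e⟫, sq_abs ⟪x, e⟫]
  have hee : ⟪e, e⟫ = (1 : ℝ) := by rw [real_inner_self_eq_norm_sq, he, one_pow]
  rw [fderiv_fderiv_eta_apply, hee, mul_one]
  refine (abs_sub _ _).trans ?_
  rw [show 48 * ((1 + ‖x‖ ^ 2) ^ 5)⁻¹ * ⟪x, e⟫ * ⟪x, e⟫ =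
      48 * (((1 + ‖x‖ ^ 2) ^ 5)⁻¹ * (⟪x, e⟫ * ⟪x, e⟫)) by ring,
    abs_of_nonneg (by nlinarith [mul_self_nonneg ⟪x, e⟫]), abs_of_nonneg (by positivity)]
  have h5 : ((1 + ‖x‖ ^ 2) ^ 5)⁻¹ * (⟪x, e⟫ * ⟪x, e⟫) ≤ ((1 + ‖x‖ ^ 2) ^ 4)⁻¹ :=
    (mul_le_mul_of_nonneg_left hxe hi5).trans h54
  have h4 : ((1 + ‖x‖ ^ 2) ^ 4)⁻¹ ≤ (((1 : ℝ) + ‖x‖ ^ 2) ^ 3)⁻¹ := h43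
  linarith

/-- `log η(x) ≥ −6 ‖x‖`. [folklore] -/
private theorem log_eta_ge (x : EuclideanSpace ℝ (Fin 2)) :
    -(6 * ‖x‖) ≤ Real.log ((((1 : ℝ) + ‖x‖ ^ 2) ^ 3)⁻¹) := by
  have h0 : (0 : ℝ) < 1 + ‖x‖ := by positivity
  have hσ : (0 : ℝ) < 1 + ‖x‖ ^ 2 := by positivity
  rw [Real.log_inv, Real.log_pow]
  have h1 : Real.log (1 + ‖x‖ ^ 2) ≤ 2 * Real.log (1 + ‖x‖) := by
    rw [← Real.log_rpow h0, show ((2 : ℝ)) = ((2 : ℕ) : ℝ) by norm_num, Real.rpow_natCast]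
    exact Real.log_le_log hσ (by nlinarith [norm_nonneg x])
  have h2 : Real.log (1 + ‖x‖) ≤ ‖x‖ := by
    have := Real.log_le_sub_one_of_pos h0; linarith
  push_cast
  linarith

end Eta

section Regularised

/-! ### §1 The regularised density `θ = ω + ε η` of a non-negative decaying `C²` function -/

/-- `(1 + ‖x‖²)³ ≤ (1 + ‖x‖)⁶`. [folklore] -/
private theorem one_add_norm_sq_pow_three_le (x : EuclideanSpace ℝ (Fin 2)) :
    (1 + ‖x‖ ^ 2) ^ 3 ≤ (1 + ‖x‖) ^ 6 := by
  have h : 1 + ‖x‖ ^ 2 ≤ (1 + ‖x‖) ^ 2 := by nlinarith [norm_nonneg x]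
  calc (1 + ‖x‖ ^ 2) ^ 3 ≤ ((1 + ‖x‖) ^ 2) ^ 3 := pow_le_pow_left₀ (by positivity) h 3
    _ = (1 + ‖x‖) ^ 6 := by ring

/-- Positivity, smoothness, the two-sided bound `ε η ≤ θ ≤ C + 1` and the linear growth of
`log θ + 1` for the regularised density `θ = w + ε η` (`w ≥ 0`, `|w| ≤ C (1+‖x‖)^{-6}`,
`0 < ε ≤ 1`): `|log θ(x) + 1| ≤ (log(C+1) + |log ε| + 7)(1 + ‖x‖)`. [folklore] -/
private theorem reg_pos_log {w : EuclideanSpace ℝ (Fin 2) → ℝ} (hw : ContDiff ℝ 2 w)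
    (hnn : ∀ x, 0 ≤ w x) {C : ℝ} (hC : 0 ≤ C) (h0 : ∀ x, |w x| ≤ C * (1 + ‖x‖) ^ (-(6 : ℝ)))
    {ε : ℝ} (hε : 0 < ε) (hε1 : ε ≤ 1) {θ : EuclideanSpace ℝ (Fin 2) → ℝ}
    (hθ : θ = fun x => w x + ε * (((1 : ℝ) + ‖x‖ ^ 2) ^ 3)⁻¹) :
    (∀ x, 0 < θ x) ∧ ContDiff ℝ 2 θ ∧ (∀ x, ε * (((1 : ℝ) + ‖x‖ ^ 2) ^ 3)⁻¹ ≤ θ x) ∧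
      (∀ x, θ x ≤ C + 1) ∧
      ∀ x, |Real.log (θ x) + 1| ≤ (Real.log (C + 1) + |Real.log ε| + 7) * (1 + ‖x‖) := by
  have hη := eta_pos_le_one
  have hlow : ∀ x, ε * (((1 : ℝ) + ‖x‖ ^ 2) ^ 3)⁻¹ ≤ θ x := fun x => by
    rw [hθ]; linarith [hnn x]
  have hpos : ∀ x, 0 < θ x := fun x =>
    lt_of_lt_of_le (mul_pos hε (hη x).1) (hlow x)
  have hup : ∀ x, θ x ≤ C + 1 := by
    intro x
    rw [hθ]
    have h1 : w x ≤ C := by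
      have := (le_abs_self _).trans (h0 x)
      exact this.trans (mul_le_of_le_one_right hC (rpow_neg_le_one x (by norm_num)))
    have h2 : ε * (((1 : ℝ) + ‖x‖ ^ 2) ^ 3)⁻¹ ≤ 1 := by
      calc ε * (((1 : ℝ) + ‖x‖ ^ 2) ^ 3)⁻¹ ≤ 1 * 1 :=
            mul_le_mul hε1 (hη x).2 (hη x).1.le zero_le_one
        _ = 1 := by ring
    show w x + ε * (((1 : ℝ) + ‖x‖ ^ 2) ^ 3)⁻¹ ≤ C + 1
    linarith
  refine ⟨hpos, ?_, hlow, hup, fun x => ?_⟩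
  · rw [hθ]
    exact hw.add (contDiff_const.mul (contDiff_infty.1 contDiff_eta 2))
  · have hlogε : Real.log ε ≤ 0 := Real.log_nonpos hε.le hε1
    have hlogC : 0 ≤ Real.log (C + 1) := Real.log_nonneg (by linarith)
    have hupper : Real.log (θ x) ≤ Real.log (C + 1) := Real.log_le_log (hpos x) (hup x)
    have hlower : Real.log ε - 6 * ‖x‖ ≤ Real.log (θ x) := by
      have h1 : Real.log (ε * (((1 : ℝ) + ‖x‖ ^ 2) ^ 3)⁻¹) ≤ Real.log (θ x) :=
        Real.log_le_log (mul_pos hε (hη x).1) (hlow x)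
      rw [Real.log_mul hε.ne' (hη x).1.ne'] at h1
      linarith [log_eta_ge x]
    have habs : |Real.log (θ x) + 1| ≤ Real.log (C + 1) + |Real.log ε| + 6 * ‖x‖ + 1 := by
      rw [abs_le, abs_of_nonpos hlogε]
      constructor <;> nlinarith [norm_nonneg x]
    refine habs.trans ?_
    have hA : 0 ≤ Real.log (C + 1) + |Real.log ε| := by positivity
    nlinarith [norm_nonneg x]

/-- Decay of the regularised density and of its derivative: `|θ| ≤ (C + 8)(1+‖x‖)^{-6}`,
`Dθ = Dw + ε Dη`, `‖Dθ‖ ≤ (C + 48)(1+‖x‖)^{-6}`. [folklore] -/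
private theorem reg_decay {w : EuclideanSpace ℝ (Fin 2) → ℝ} (hw : ContDiff ℝ 2 w)
    (hnn : ∀ x, 0 ≤ w x) {C : ℝ} (h0 : ∀ x, |w x| ≤ C * (1 + ‖x‖) ^ (-(6 : ℝ)))
    (h1 : ∀ x, ‖fderiv ℝ w x‖ ≤ C * (1 + ‖x‖) ^ (-(6 : ℝ)))
    {ε : ℝ} (hε : 0 < ε) (hε1 : ε ≤ 1) {θ : EuclideanSpace ℝ (Fin 2) → ℝ}
    (hθ : θ = fun x => w x + ε * (((1 : ℝ) + ‖x‖ ^ 2) ^ 3)⁻¹) :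
    (∀ x, |θ x| ≤ (C + 8) * (1 + ‖x‖) ^ (-(6 : ℝ))) ∧
      (fderiv ℝ θ = fun x => fderiv ℝ w x +
        ε • fderiv ℝ (fun y : EuclideanSpace ℝ (Fin 2) => (((1 : ℝ) + ‖y‖ ^ 2) ^ 3)⁻¹) x) ∧
      ∀ x, ‖fderiv ℝ θ x‖ ≤ (C + 48) * (1 + ‖x‖) ^ (-(6 : ℝ)) := by
  have hη := eta_pos_le_one
  have hw6 : ∀ x : EuclideanSpace ℝ (Fin 2), (0 : ℝ) ≤ (1 + ‖x‖) ^ (-(6 : ℝ)) := fun x =>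
    Real.rpow_nonneg (by positivity) _
  have hηd : Differentiable ℝ (fun y : EuclideanSpace ℝ (Fin 2) => (((1 : ℝ) + ‖y‖ ^ 2) ^ 3)⁻¹) :=
    contDiff_eta.differentiable (by simp)
  have hwd : Differentiable ℝ w := hw.differentiable (by norm_num)
  have hD : fderiv ℝ θ = fun x => fderiv ℝ w x +
      ε • fderiv ℝ (fun y : EuclideanSpace ℝ (Fin 2) => (((1 : ℝ) + ‖y‖ ^ 2) ^ 3)⁻¹) x := by
    funext x
    rw [hθ]
    exact (((hwd x).hasFDerivAt).add (((hηd x).hasFDerivAt).const_mul ε)).fderiv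
  refine ⟨fun x => ?_, hD, fun x => ?_⟩
  · rw [hθ]
    show |w x + ε * (((1 : ℝ) + ‖x‖ ^ 2) ^ 3)⁻¹| ≤ (C + 8) * (1 + ‖x‖) ^ (-(6 : ℝ))
    rw [abs_of_nonneg (by nlinarith [hnn x, (hη x).1, hε])]
    have h2 : ε * (((1 : ℝ) + ‖x‖ ^ 2) ^ 3)⁻¹ ≤ 8 * (1 + ‖x‖) ^ (-(6 : ℝ)) := by
      calc ε * (((1 : ℝ) + ‖x‖ ^ 2) ^ 3)⁻¹ ≤ 1 * (8 * (1 + ‖x‖) ^ (-(6 : ℝ))) :=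
            mul_le_mul hε1 (eta_le_rpow x) (hη x).1.le zero_le_one
        _ = 8 * (1 + ‖x‖) ^ (-(6 : ℝ)) := by ring
    have h3 : w x ≤ C * (1 + ‖x‖) ^ (-(6 : ℝ)) := (le_abs_self _).trans (h0 x)
    linarith
  · rw [hD]
    refine (norm_add_le _ _).trans ?_
    rw [norm_smul, Real.norm_of_nonneg hε.le]
    have h2 : ε * ‖fderiv ℝ (fun y : EuclideanSpace ℝ (Fin 2) => (((1 : ℝ) + ‖y‖ ^ 2) ^ 3)⁻¹) x‖ ≤
        48 * (1 + ‖x‖) ^ (-(6 : ℝ)) := by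
      calc ε * ‖fderiv ℝ (fun y : EuclideanSpace ℝ (Fin 2) => (((1 : ℝ) + ‖y‖ ^ 2) ^ 3)⁻¹) x‖
          ≤ 1 * (6 * (8 * (1 + ‖x‖) ^ (-(6 : ℝ)))) := by
            refine mul_le_mul hε1 ((norm_fderiv_eta_le x).trans ?_) (norm_nonneg _) zero_le_one
            exact mul_le_mul_of_nonneg_left (eta_le_rpow x) (by norm_num)
        _ = 48 * (1 + ‖x‖) ^ (-(6 : ℝ)) := by ring
    linarith [h1 x]

/-- The integrability package of the regularised density: `θ`, `‖x‖² θ`, `θ log θ`,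
`‖Dθ‖²/θ ∈ L¹(ℝ²)` and `∫ θ = ∫ w + ε ∫ η`. [folklore] -/
private theorem reg_integrable {w : EuclideanSpace ℝ (Fin 2) → ℝ} (hw : ContDiff ℝ 2 w)
    (hnn : ∀ x, 0 ≤ w x) {C : ℝ} (hC : 0 ≤ C) (h0 : ∀ x, |w x| ≤ C * (1 + ‖x‖) ^ (-(6 : ℝ)))
    (h1 : ∀ x, ‖fderiv ℝ w x‖ ≤ C * (1 + ‖x‖) ^ (-(6 : ℝ)))
    {ε : ℝ} (hε : 0 < ε) (hε1 : ε ≤ 1) {θ : EuclideanSpace ℝ (Fin 2) → ℝ}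
    (hθ : θ = fun x => w x + ε * (((1 : ℝ) + ‖x‖ ^ 2) ^ 3)⁻¹) :
    Integrable θ (volume : Measure (EuclideanSpace ℝ (Fin 2))) ∧
      Integrable (fun x => ‖x‖ ^ 2 * θ x) (volume : Measure (EuclideanSpace ℝ (Fin 2))) ∧
      Integrable (fun x => θ x * Real.log (θ x)) (volume : Measure (EuclideanSpace ℝ (Fin 2))) ∧
      Integrable (fun x => ‖fderiv ℝ θ x‖ ^ 2 / θ x) (volume : Measure (EuclideanSpace ℝ (Fin 2))) ∧
      Integrable (fun x : EuclideanSpace ℝ (Fin 2) => (((1 : ℝ) + ‖x‖ ^ 2) ^ 3)⁻¹)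
        (volume : Measure (EuclideanSpace ℝ (Fin 2))) ∧
      (∫ x, θ x = (∫ x, w x) + ε * ∫ x : EuclideanSpace ℝ (Fin 2), (((1 : ℝ) + ‖x‖ ^ 2) ^ 3)⁻¹) := by
  obtain ⟨hpos, hθ2, hlow, hup, hlog⟩ := reg_pos_log hw hnn hC h0 hε hε1 hθ
  obtain ⟨hθ0, -, hθ1⟩ := reg_decay hw hnn h0 h1 hε hε1 hθ
  have hη := eta_pos_le_one
  have hθc : Continuous θ := hθ2.continuous
  have hDθc : Continuous (fderiv ℝ θ) := hθ2.continuous_fderiv (by norm_num)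
  have hd2 : (Module.finrank ℝ (EuclideanSpace ℝ (Fin 2)) : ℝ) = 2 := by
    rw [finrank_euclideanSpace_fin]; norm_num
  have hx0 : ∀ x : EuclideanSpace ℝ (Fin 2), (0 : ℝ) < 1 + ‖x‖ := fun x => by positivity
  set A : ℝ := Real.log (C + 1) + |Real.log ε| + 7 with hA
  have hA0 : 0 ≤ A := by
    have : 0 ≤ Real.log (C + 1) := Real.log_nonneg (by linarith)
    positivity
  -- `η ∈ L¹`
  have hηi : Integrable (fun x : EuclideanSpace ℝ (Fin 2) => (((1 : ℝ) + ‖x‖ ^ 2) ^ 3)⁻¹)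
      (volume : Measure (EuclideanSpace ℝ (Fin 2))) := by
    refine integrable_of_norm_le_rpow_neg contDiff_eta.continuous (C := 8) (r := 6)
      (by rw [hd2]; norm_num) fun x => ?_
    rw [Real.norm_of_nonneg (hη x).1.le]
    exact eta_le_rpow x
  -- `θ ∈ L¹`
  have hθi : Integrable θ (volume : Measure (EuclideanSpace ℝ (Fin 2))) := by
    refine integrable_of_norm_le_rpow_neg hθc (C := C + 8) (r := 6) (by rw [hd2]; norm_num)
      fun x => ?_
    rw [Real.norm_eq_abs]; exact hθ0 x
  refine ⟨hθi, ?_, ?_, ?_, hηi, ?_⟩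
  · -- `‖x‖² θ`
    refine integrable_of_norm_le_rpow_neg ((continuous_norm.pow 2).mul hθc) (C := C + 8) (r := 4)
      (by rw [hd2]; norm_num) fun x => ?_
    rw [norm_mul, norm_pow, norm_norm, Real.norm_eq_abs]
    have h2 : ‖x‖ ^ 2 ≤ (1 + ‖x‖) ^ 2 := by gcongr; linarith [norm_nonneg x]
    calc ‖x‖ ^ 2 * |θ x| ≤ (1 + ‖x‖) ^ 2 * ((C + 8) * (1 + ‖x‖) ^ (-(6 : ℝ))) :=
          mul_le_mul h2 (hθ0 x) (abs_nonneg _) (by positivity)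
      _ = (C + 8) * ((1 + ‖x‖) ^ 2 * (1 + ‖x‖) ^ (-((2 + 4 : ℕ) : ℝ))) := by norm_num; ring
      _ = (C + 8) * (1 + ‖x‖) ^ (-(4 : ℝ)) := by
          rw [pow_mul_rpow_neg_add' x 2 4]; norm_num
  · -- `θ log θ`
    refine integrable_of_norm_le_rpow_neg (hθc.mul (hθc.log fun x => (hpos x).ne'))
      (C := (C + 8) * (A + 1)) (r := 5) (by rw [hd2]; norm_num) fun x => ?_
    rw [norm_mul, Real.norm_eq_abs, Real.norm_eq_abs]
    have hl : |Real.log (θ x)| ≤ (A + 1) * (1 + ‖x‖) := by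
      have h := hlog x
      have h' : |Real.log (θ x)| ≤ |Real.log (θ x) + 1| + 1 := by
        have h'' := abs_sub (Real.log (θ x) + 1) 1
        simp only [add_sub_cancel_right, abs_one] at h''
        exact h''
      linarith [norm_nonneg x]
    calc |θ x| * |Real.log (θ x)| ≤ (C + 8) * (1 + ‖x‖) ^ (-(6 : ℝ)) * ((A + 1) * (1 + ‖x‖)) :=
          mul_le_mul (hθ0 x) hl (abs_nonneg _) (by positivity)
      _ = (C + 8) * (A + 1) * ((1 + ‖x‖) ^ 1 * (1 + ‖x‖) ^ (-((1 + 5 : ℕ) : ℝ))) := by norm_num; ring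
      _ = (C + 8) * (A + 1) * (1 + ‖x‖) ^ (-(5 : ℝ)) := by
          rw [pow_mul_rpow_neg_add' x 1 5]; norm_num
  · -- the Fisher information density `‖Dθ‖²/θ ≤ ‖Dθ‖²/(ε η)`
    refine integrable_of_norm_le_rpow_neg ((hDθc.norm.pow 2).div hθc fun x => (hpos x).ne')
      (C := (C + 48) ^ 2 / ε) (r := 6) (by rw [hd2]; norm_num) fun x => ?_
    rw [Real.norm_of_nonneg (div_nonneg (sq_nonneg _) (hpos x).le)]
    have hηx := (hη x).1
    have hεη : 0 < ε * (((1 : ℝ) + ‖x‖ ^ 2) ^ 3)⁻¹ := mul_pos hε hηx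
    calc ‖fderiv ℝ θ x‖ ^ 2 / θ x ≤ ‖fderiv ℝ θ x‖ ^ 2 / (ε * (((1 : ℝ) + ‖x‖ ^ 2) ^ 3)⁻¹) :=
          div_le_div_of_nonneg_left (sq_nonneg _) hεη (hlow x)
      _ ≤ ((C + 48) * (1 + ‖x‖) ^ (-(6 : ℝ))) ^ 2 / (ε * (((1 : ℝ) + ‖x‖ ^ 2) ^ 3)⁻¹) := by
          gcongr; exact hθ1 x
      _ = (C + 48) ^ 2 / ε * ((1 + ‖x‖) ^ (-(6 : ℝ)) * ((1 + ‖x‖) ^ (-(6 : ℝ)) * (1 + ‖x‖ ^ 2) ^ 3)) := by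
          field_simp
      _ ≤ (C + 48) ^ 2 / ε * ((1 + ‖x‖) ^ (-(6 : ℝ)) * 1) := by
          gcongr
          calc (1 + ‖x‖) ^ (-(6 : ℝ)) * (1 + ‖x‖ ^ 2) ^ 3 ≤ (1 + ‖x‖) ^ (-(6 : ℝ)) * (1 + ‖x‖) ^ 6 :=
                mul_le_mul_of_nonneg_left (one_add_norm_sq_pow_three_le x)
                  (Real.rpow_nonneg (hx0 x).le _)
            _ = 1 := by
                rw [show ((1 + ‖x‖) ^ 6 : ℝ) = (1 + ‖x‖) ^ ((6 : ℕ) : ℝ) from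
                  (Real.rpow_natCast _ 6).symm, ← Real.rpow_add (hx0 x)]
                norm_num
      _ = (C + 48) ^ 2 / ε * (1 + ‖x‖) ^ (-(6 : ℝ)) := by ring
  · -- the mass
    have hwi : Integrable w (volume : Measure (EuclideanSpace ℝ (Fin 2))) :=
      integrable_of_norm_le_rpow_neg hw.continuous (C := C) (r := 6) (by rw [hd2]; norm_num)
        fun x => by rw [Real.norm_eq_abs]; exact h0 x
    have e : (∫ x, θ x) = ∫ x, (w x + ε * (((1 : ℝ) + ‖x‖ ^ 2) ^ 3)⁻¹) := by rw [hθ]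
    rw [e, integral_add hwi (hηi.const_mul ε), integral_const_mul]

end Regularised

section Balance

variable {S : Set ℝ} {ν : ℝ} {f u : ℝ → EuclideanSpace ℝ (Fin 2) → EuclideanSpace ℝ (Fin 2)}
  {p : ℝ → EuclideanSpace ℝ (Fin 2) → ℝ}

/-! ### §2 The regularised Boltzmann entropy balance at a fixed time -/

/-- `dim ℝ² = 2`. [folklore] -/
private theorem finrank_two : (Module.finrank ℝ (EuclideanSpace ℝ (Fin 2)) : ℝ) = 2 := by
  rw [finrank_euclideanSpace_fin]; norm_num

/-- The tree's weight exponent `0 + (dim ℝ² + 1)` is `3`. [folklore] -/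
private theorem weightExp_eq_three' :
    ((0 + (Module.finrank ℝ (EuclideanSpace ℝ (Fin 2)) + 1) : ℕ) : ℝ) = 3 := by
  rw [finrank_euclideanSpace_fin]; norm_num

/-- The uniform decay package of the vorticity at the weight exponent `6`: ONE constant `C ≥ 0`
with `|ω|, ‖∇ω‖, ‖∇²ω‖, |∂ₜω| ≤ C (1 + ‖x‖)^{-6}` on `S × ℝ²`. [folklore] -/
private theorem exists_planarVorticity_decay₆ (hu : IsSmoothSpaceTimeOn S u) (hU : UniqueDiffOn ℝ S)
    (hω : HasUniformRapidDecayOn S (fun t x => PlanarEigenmode.vorticity (u t) x)) :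
    ∃ C : ℝ, 0 ≤ C ∧ ∀ t ∈ S, ∀ x : EuclideanSpace ℝ (Fin 2),
      |PlanarEigenmode.vorticity (u t) x| ≤ C * (1 + ‖x‖) ^ (-(6 : ℝ)) ∧
        ‖fderiv ℝ (PlanarEigenmode.vorticity (u t)) x‖ ≤ C * (1 + ‖x‖) ^ (-(6 : ℝ)) ∧
        ‖fderiv ℝ (fderiv ℝ (PlanarEigenmode.vorticity (u t))) x‖ ≤ C * (1 + ‖x‖) ^ (-(6 : ℝ)) ∧
        |timeDerivWithin S (fun s y => PlanarEigenmode.vorticity (u s) y) t x| ≤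
          C * (1 + ‖x‖) ^ (-(6 : ℝ)) := by
  have hsm := PlanarEigenmode.isSmoothSpaceTimeOn_vorticity hu hU
  obtain ⟨A0, hA0, hA0b⟩ := hω.norm_le_rpow 6
  obtain ⟨A1, hA1, hA1b⟩ := hω.norm_fderiv_le_rpow hsm hU 6
  obtain ⟨A2, hA2, hA2b⟩ := hω.norm_fderiv_fderiv_le_rpow hsm hU 6
  obtain ⟨A3, hA3, hA3b⟩ := hω.norm_timeDerivWithin_le_rpow hsm hU 6
  have e6 : ((6 : ℕ) : ℝ) = 6 := by norm_num
  refine ⟨A0 + A1 + A2 + A3, by positivity, fun t ht x => ⟨?_, ?_, ?_, ?_⟩⟩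
  · have h := hA0b t ht x
    rw [Real.norm_eq_abs, e6] at h
    exact le_decay_of_le_decay x h (by linarith)
  · have h := hA1b t ht x
    rw [e6] at h
    exact le_decay_of_le_decay x h (by linarith)
  · have h := hA2b t ht x
    rw [e6] at h
    exact le_decay_of_le_decay x h (by linarith)
  · have h := hA3b t ht x
    rw [Real.norm_eq_abs, e6] at h
    exact le_decay_of_le_decay x h (by linarith)

/-- The derivative of `θ log θ` for a positive `C¹` scalar: `D(θ log θ)_x = (log θ(x) + 1) Dθ_x`.
[folklore] -/
private theorem fderiv_mul_log_eq' {w : EuclideanSpace ℝ (Fin 2) → ℝ} (hw : Differentiable ℝ w)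
    (hpos : ∀ x, 0 < w x) (x : EuclideanSpace ℝ (Fin 2)) :
    fderiv ℝ (fun y => w y * Real.log (w y)) x = (Real.log (w x) + 1) • fderiv ℝ w x := by
  have h1 := (hw x).hasFDerivAt
  have h2 := h1.log (hpos x).ne'
  have h3 : HasFDerivAt (fun y => w y * Real.log (w y))
      (w x • ((w x)⁻¹ • fderiv ℝ w x) + Real.log (w x) • fderiv ℝ w x) x := h1.mul h2
  rw [h3.fderiv, smul_smul, mul_inv_cancel₀ (hpos x).ne', add_comm, add_smul, one_smul]

/-- The derivative of `log θ + 1` for a positive `C¹` scalar: `D(log θ + 1)_x = θ(x)⁻¹ Dθ_x`.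
[folklore] -/
private theorem fderiv_log_eq' {w : EuclideanSpace ℝ (Fin 2) → ℝ} (hw : Differentiable ℝ w)
    (hpos : ∀ x, 0 < w x) (x : EuclideanSpace ℝ (Fin 2)) :
    fderiv ℝ (fun y => Real.log (w y) + 1) x = (w x)⁻¹ • fderiv ℝ w x := by
  have h2 := ((hw x).hasFDerivAt.log (hpos x).ne').add_const (1 : ℝ)
  rw [h2.fderiv]

/-- **The regularised Boltzmann entropy balance at a fixed time.** Let `(u, p)` be a classical
planar solution with curl-free force at `t ∈ S` (unique differentiability), non-negative vorticity
`ω(t) ≥ 0` with uniform rapid decay, `u(t)` bounded by `M`; put `θ = ω(t) + ε η`,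
`η(x) = ((1+‖x‖²)³)⁻¹`, `0 < ε ≤ 1`. Then
`∫ (log θ + 1) ∂ₜω = −ν ∫ ‖∇θ‖²/θ + ε ∫ (log θ + 1)(∇η·u − νΔη)`:
the vorticity equation against the TAME weight `log θ + 1` (`log θ ≥ log ε − 6‖x‖`), the transport
term `∫ (u·∇)(θ log θ) = 0` and Green's identity `∫ (log θ + 1) Δθ = −∫ ‖∇θ‖²/θ` being EXACT for
the positive function `θ`, and the two `ε η`-corrections collected on the right. (Gallay–Wayne's
computation of `dH/dτ`, proof of Lemma 3.2, with the Gaussian lower bound replaced by the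
regularisation.) [cite: GallayWayne2005, Lemma 3.2 (proof, p. 12)] -/
private theorem reg_balance (h : IsClassicalNSSolutionOn S ν f u p) (hU : UniqueDiffOn ℝ S) {t : ℝ}
    (ht : t ∈ S) {M : ℝ} (hM : ∀ x, ‖u t x‖ ≤ M)
    (hcurl : ∀ x, PlanarEigenmode.vorticity (f t) x = 0)
    (hnn : ∀ x, 0 ≤ PlanarEigenmode.vorticity (u t) x) {C : ℝ} (hC : 0 ≤ C)
    (hdec : ∀ x, |PlanarEigenmode.vorticity (u t) x| ≤ C * (1 + ‖x‖) ^ (-(6 : ℝ)) ∧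
        ‖fderiv ℝ (PlanarEigenmode.vorticity (u t)) x‖ ≤ C * (1 + ‖x‖) ^ (-(6 : ℝ)) ∧
        ‖fderiv ℝ (fderiv ℝ (PlanarEigenmode.vorticity (u t))) x‖ ≤ C * (1 + ‖x‖) ^ (-(6 : ℝ)) ∧
        |timeDerivWithin S (fun s y => PlanarEigenmode.vorticity (u s) y) t x| ≤
          C * (1 + ‖x‖) ^ (-(6 : ℝ)))
    {ε : ℝ} (hε : 0 < ε) (hε1 : ε ≤ 1) {θ : EuclideanSpace ℝ (Fin 2) → ℝ}
    (hθ : θ = fun x => PlanarEigenmode.vorticity (u t) x + ε * (((1 : ℝ) + ‖x‖ ^ 2) ^ 3)⁻¹) :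
    Integrable (fun x => (Real.log (θ x) + 1) *
        (fderiv ℝ (fun w : EuclideanSpace ℝ (Fin 2) => (((1 : ℝ) + ‖w‖ ^ 2) ^ 3)⁻¹) x (u t x) -
          ν * (Δ (fun w : EuclideanSpace ℝ (Fin 2) => (((1 : ℝ) + ‖w‖ ^ 2) ^ 3)⁻¹)) x))
        (volume : Measure (EuclideanSpace ℝ (Fin 2))) ∧
      (∀ x, |(Real.log (θ x) + 1) *
        (fderiv ℝ (fun w : EuclideanSpace ℝ (Fin 2) => (((1 : ℝ) + ‖w‖ ^ 2) ^ 3)⁻¹) x (u t x) -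
          ν * (Δ (fun w : EuclideanSpace ℝ (Fin 2) => (((1 : ℝ) + ‖w‖ ^ 2) ^ 3)⁻¹)) x)| ≤
        (Real.log (C + 1) + |Real.log ε| + 7) * (6 * M + 60 * |ν|) * (8 * (1 + ‖x‖) ^ (-(5 : ℝ)))) ∧
      ∫ x, (Real.log (θ x) + 1) * timeDerivWithin S (fun s y => PlanarEigenmode.vorticity (u s) y) t x =
        -(ν * ∫ x, ‖fderiv ℝ θ x‖ ^ 2 / θ x) +
          ε * ∫ x, (Real.log (θ x) + 1) *
            (fderiv ℝ (fun w : EuclideanSpace ℝ (Fin 2) => (((1 : ℝ) + ‖w‖ ^ 2) ^ 3)⁻¹) x (u t x) -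
              ν * (Δ (fun w : EuclideanSpace ℝ (Fin 2) => (((1 : ℝ) + ‖w‖ ^ 2) ^ 3)⁻¹)) x) := by
  -- abbreviations
  set w : EuclideanSpace ℝ (Fin 2) → ℝ := PlanarEigenmode.vorticity (u t) with hw
  set wt : EuclideanSpace ℝ (Fin 2) → ℝ :=
    timeDerivWithin S (fun s y => PlanarEigenmode.vorticity (u s) y) t with hwt
  set η : EuclideanSpace ℝ (Fin 2) → ℝ := fun w => (((1 : ℝ) + ‖w‖ ^ 2) ^ 3)⁻¹ with hηdef
  set φ : EuclideanSpace ℝ (Fin 2) → ℝ := fun x => Real.log (θ x) + 1 with hφ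
  set A : ℝ := Real.log (C + 1) + |Real.log ε| + 7 with hA
  have h0 : ∀ x, |w x| ≤ C * (1 + ‖x‖) ^ (-(6 : ℝ)) := fun x => (hdec x).1
  have h1 : ∀ x, ‖fderiv ℝ w x‖ ≤ C * (1 + ‖x‖) ^ (-(6 : ℝ)) := fun x => (hdec x).2.1
  have h2 : ∀ x, ‖fderiv ℝ (fderiv ℝ w) x‖ ≤ C * (1 + ‖x‖) ^ (-(6 : ℝ)) := fun x => (hdec x).2.2.1
  have h3 : ∀ x, |wt x| ≤ C * (1 + ‖x‖) ^ (-(6 : ℝ)) := fun x => (hdec x).2.2.2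
  have hw6 : ∀ x : EuclideanSpace ℝ (Fin 2), (0 : ℝ) ≤ (1 + ‖x‖) ^ (-(6 : ℝ)) := fun x =>
    Real.rpow_nonneg (by positivity) _
  have hx0 : ∀ x : EuclideanSpace ℝ (Fin 2), (0 : ℝ) < 1 + ‖x‖ := fun x => by positivity
  -- regularity of the slices
  have hsm := PlanarEigenmode.isSmoothSpaceTimeOn_vorticity h.smooth_velocity hU
  have hw2 : ContDiff ℝ 2 w := contDiff_infty.1 (hsm.contDiff_slice ht) 2
  have hu1 : ContDiff ℝ 1 (u t) := contDiff_infty.1 (h.contDiff_velocity ht) 1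
  have huc : Continuous (u t) := hu1.continuous
  have hD2wc : Continuous (fderiv ℝ (fderiv ℝ w)) := hsm.continuous_fderiv_fderiv_slice ht
  have hwtc : Continuous wt := hsm.continuous_timeDerivWithin hU ht
  have hM0 : 0 ≤ M := (norm_nonneg _).trans (hM 0)
  -- the regularised density
  obtain ⟨hpos, hθ2, hlow, hup, hφ0⟩ := reg_pos_log hw2 hnn hC h0 hε hε1 hθ
  obtain ⟨hθ0, hDθ, hθ1⟩ := reg_decay hw2 hnn h0 h1 hε hε1 hθ
  obtain ⟨hθi, -, hθlogi, hFi, hηi, -⟩ := reg_integrable hw2 hnn hC h0 h1 hε hε1 hθ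
  have hA0 : 0 ≤ A := by
    have : 0 ≤ Real.log (C + 1) := Real.log_nonneg (by linarith)
    positivity
  have hη := eta_pos_le_one
  have hηC : ContDiff ℝ ∞ η := contDiff_eta
  have hηc : Continuous η := hηC.continuous
  have hDηc : Continuous (fderiv ℝ η) := hηC.continuous_fderiv (by simp)
  have hΔηc : Continuous (Δ η) := continuous_laplacian (contDiff_infty.1 hηC 2)
  have hθ1' : ContDiff ℝ 1 θ := hθ2.of_le (by norm_num)
  have hθd : Differentiable ℝ θ := hθ1'.differentiable (by norm_num)
  have hθc : Continuous θ := hθ2.continuous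
  have hDθc : Continuous (fderiv ℝ θ) := hθ2.continuous_fderiv (by norm_num)
  have hD2θc : Continuous (fderiv ℝ (fderiv ℝ θ)) :=
    (hθ2.fderiv_right (m := 1) (by norm_num)).continuous_fderiv (by norm_num)
  have hne : ∀ x, θ x ≠ 0 := fun x => (hpos x).ne'
  have hφ1 : ContDiff ℝ 1 φ := (hθ1'.log hne).add contDiff_const
  have hφc : Continuous φ := hφ1.continuous
  have hDφ : ∀ x, fderiv ℝ φ x = (θ x)⁻¹ • fderiv ℝ θ x := fderiv_log_eq' hθd hpos
  -- (i) the residual integrand: integrability and the uniform bound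
  have hres : ∀ x, |φ x * (fderiv ℝ η x (u t x) - ν * (Δ η) x)| ≤
      A * (6 * M + 60 * |ν|) * (8 * (1 + ‖x‖) ^ (-(5 : ℝ))) := by
    intro x
    rw [abs_mul]
    have hb : |fderiv ℝ η x (u t x) - ν * (Δ η) x| ≤ (6 * M + 60 * |ν|) * η x := by
      refine (abs_sub _ _).trans ?_
      have e1 : |fderiv ℝ η x (u t x)| ≤ 6 * η x * M := by
        calc |fderiv ℝ η x (u t x)| = ‖fderiv ℝ η x (u t x)‖ := (Real.norm_eq_abs _).symm
          _ ≤ ‖fderiv ℝ η x‖ * ‖u t x‖ := ContinuousLinearMap.le_opNorm _ _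
          _ ≤ 6 * η x * M := mul_le_mul (norm_fderiv_eta_le x) (hM x) (norm_nonneg _)
              (by nlinarith [(hη x).1])
      have e2 : |ν * (Δ η) x| ≤ |ν| * (60 * η x) := by
        rw [abs_mul]; exact mul_le_mul_of_nonneg_left (abs_laplacian_eta_le x) (abs_nonneg ν)
      nlinarith [e1, e2, (hη x).1]
    calc |φ x| * |fderiv ℝ η x (u t x) - ν * (Δ η) x|
        ≤ A * (1 + ‖x‖) * ((6 * M + 60 * |ν|) * η x) :=
          mul_le_mul (hφ0 x) hb (abs_nonneg _) (by positivity)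
      _ ≤ A * (1 + ‖x‖) * ((6 * M + 60 * |ν|) * (8 * (1 + ‖x‖) ^ (-(6 : ℝ)))) := by
          gcongr; exact eta_le_rpow x
      _ = A * (6 * M + 60 * |ν|) * (8 * ((1 + ‖x‖) ^ 1 * (1 + ‖x‖) ^ (-((1 + 5 : ℕ) : ℝ)))) := by
          norm_num; ring
      _ = A * (6 * M + 60 * |ν|) * (8 * (1 + ‖x‖) ^ (-(5 : ℝ))) := by
          rw [pow_mul_rpow_neg_add' x 1 5]; norm_num
  have hIres : Integrable (fun x => φ x * (fderiv ℝ η x (u t x) - ν * (Δ η) x))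
      (volume : Measure (EuclideanSpace ℝ (Fin 2))) := by
    refine integrable_of_norm_le_rpow_neg (hφc.mul ((hDηc.clm_apply huc).sub
      (continuous_const.mul hΔηc))) (C := A * (6 * M + 60 * |ν|) * 8) (r := 5)
      (by rw [finrank_two]; norm_num) fun x => ?_
    rw [Real.norm_eq_abs]
    exact (hres x).trans (le_of_eq (by ring))
  refine ⟨hIres, hres, ?_⟩
  -- (ii) integrability of the pairings of `φ` with `∂ₜω`, `∇ω·u`, `Δω`, `∇η·u`, `Δη`
  have hIpair : ∀ {g : EuclideanSpace ℝ (Fin 2) → ℝ}, Continuous g → ∀ K : ℝ,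
      (∀ x, |g x| ≤ K * (1 + ‖x‖) ^ (-(6 : ℝ))) →
      Integrable (fun x => φ x * g x) (volume : Measure (EuclideanSpace ℝ (Fin 2))) := by
    intro g hg K hK
    refine integrable_of_norm_le_rpow_neg (hφc.mul hg) (C := A * K) (r := 5)
      (by rw [finrank_two]; norm_num) fun x => ?_
    rw [norm_mul, Real.norm_eq_abs, Real.norm_eq_abs]
    have hK0 : 0 ≤ K * (1 + ‖x‖) ^ (-(6 : ℝ)) := (abs_nonneg _).trans (hK x)
    calc |φ x| * |g x| ≤ A * (1 + ‖x‖) * (K * (1 + ‖x‖) ^ (-(6 : ℝ))) :=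
          mul_le_mul (hφ0 x) (hK x) (abs_nonneg _) (by positivity)
      _ = A * K * ((1 + ‖x‖) ^ 1 * (1 + ‖x‖) ^ (-((1 + 5 : ℕ) : ℝ))) := by norm_num; ring
      _ = A * K * (1 + ‖x‖) ^ (-(5 : ℝ)) := by rw [pow_mul_rpow_neg_add' x 1 5]; norm_num
  have hIt : Integrable (fun x => φ x * wt x) (volume : Measure (EuclideanSpace ℝ (Fin 2))) :=
    hIpair hwtc C h3
  have hIc : Integrable (fun x => φ x * fderiv ℝ w x (u t x))
      (volume : Measure (EuclideanSpace ℝ (Fin 2))) := by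
    refine hIpair ((hw2.continuous_fderiv (by norm_num)).clm_apply huc) (C * M) fun x => ?_
    calc |fderiv ℝ w x (u t x)| = ‖fderiv ℝ w x (u t x)‖ := (Real.norm_eq_abs _).symm
      _ ≤ ‖fderiv ℝ w x‖ * ‖u t x‖ := ContinuousLinearMap.le_opNorm _ _
      _ ≤ C * (1 + ‖x‖) ^ (-(6 : ℝ)) * M := mul_le_mul (h1 x) (hM x) (norm_nonneg _)
          (mul_nonneg hC (hw6 x))
      _ = C * M * (1 + ‖x‖) ^ (-(6 : ℝ)) := by ring
  have hIΔ : Integrable (fun x => φ x * (Δ w) x) (volume : Measure (EuclideanSpace ℝ (Fin 2))) := by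
    refine hIpair (continuous_laplacian hw2) (2 * C) fun x => ?_
    calc |(Δ w) x| = ‖(Δ w) x‖ := (Real.norm_eq_abs _).symm
      _ ≤ Module.finrank ℝ (EuclideanSpace ℝ (Fin 2)) * ‖fderiv ℝ (fderiv ℝ w) x‖ :=
          norm_laplacian_le w x
      _ = 2 * ‖fderiv ℝ (fderiv ℝ w) x‖ := by rw [finrank_euclideanSpace_fin]; norm_num
      _ ≤ 2 * (C * (1 + ‖x‖) ^ (-(6 : ℝ))) := by gcongr; exact h2 x
      _ = 2 * C * (1 + ‖x‖) ^ (-(6 : ℝ)) := by ring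
  have hIηc : Integrable (fun x => φ x * fderiv ℝ η x (u t x))
      (volume : Measure (EuclideanSpace ℝ (Fin 2))) := by
    refine hIpair (hDηc.clm_apply huc) (6 * 8 * M) fun x => ?_
    calc |fderiv ℝ η x (u t x)| = ‖fderiv ℝ η x (u t x)‖ := (Real.norm_eq_abs _).symm
      _ ≤ ‖fderiv ℝ η x‖ * ‖u t x‖ := ContinuousLinearMap.le_opNorm _ _
      _ ≤ 6 * (8 * (1 + ‖x‖) ^ (-(6 : ℝ))) * M :=
          mul_le_mul ((norm_fderiv_eta_le x).trans (by gcongr; exact eta_le_rpow x)) (hM x)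
            (norm_nonneg _) (by positivity)
      _ = 6 * 8 * M * (1 + ‖x‖) ^ (-(6 : ℝ)) := by ring
  have hIηΔ : Integrable (fun x => φ x * (Δ η) x) (volume : Measure (EuclideanSpace ℝ (Fin 2))) := by
    refine hIpair hΔηc (60 * 8) fun x => ?_
    calc |(Δ η) x| ≤ 60 * η x := abs_laplacian_eta_le x
      _ ≤ 60 * (8 * (1 + ‖x‖) ^ (-(6 : ℝ))) := by gcongr; exact eta_le_rpow x
      _ = 60 * 8 * (1 + ‖x‖) ^ (-(6 : ℝ)) := by ring
  -- (iii) the vorticity equation (2.6) at `t`, weighted by `φ` (curl-free force)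
  have hpt : ∀ x, φ x * wt x = -(φ x * fderiv ℝ w x (u t x)) + ν * (φ x * (Δ w) x) := by
    intro x
    have he := h.planarVorticity_eq hU ht x
    rw [convect_apply, hcurl x, add_zero] at he
    linear_combination (φ x) * he
  -- (iv) `∇ω = ∇θ − ε ∇η` and `Δω = Δθ − ε Δη`
  have hDw : ∀ x v, fderiv ℝ w x v = fderiv ℝ θ x v - ε * fderiv ℝ η x v := by
    intro x v
    have e := congrFun hDθ x
    have e2 : fderiv ℝ θ x v = fderiv ℝ w x v + ε * fderiv ℝ η x v := by
      rw [e]; simp [hηdef]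
    rw [e2]; ring
  have hθfun : θ = w + ε • η := by
    rw [hθ]; funext x; simp [hηdef]
  have hΔw : ∀ x, (Δ w) x = (Δ θ) x - ε * (Δ η) x := by
    intro x
    have hwx : ContDiffAt ℝ 2 w x := hw2.contDiffAt
    have hηx : ContDiffAt ℝ 2 η x := (contDiff_infty.1 hηC 2).contDiffAt
    have hεη : ContDiffAt ℝ 2 (ε • η) x := hηx.const_smul ε
    rw [hθfun, hwx.laplacian_add hεη, laplacian_smul ε hηx, smul_eq_mul]
    ring
  -- (a) the transport term: `∫ φ ∇θ·u = ∫ (u·∇)(θ log θ) = 0`, so `∫ φ ∇ω·u = −ε ∫ φ ∇η·u`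
  have hT0 : ∫ x, φ x * fderiv ℝ θ x (u t x) = 0 := by
    set Θ : EuclideanSpace ℝ (Fin 2) → ℝ := fun y => θ y * Real.log (θ y) with hΘ
    have hΘ1 : ContDiff ℝ 1 Θ := hθ1'.mul (hθ1'.log hne)
    have hDΘ : ∀ x, fderiv ℝ Θ x = φ x • fderiv ℝ θ x := fderiv_mul_log_eq' hθd hpos
    have hK : ∀ x : EuclideanSpace ℝ (Fin 2), (C + 48) * (1 + ‖x‖) ^ (-(6 : ℝ)) * ((A + 1) * (1 + ‖x‖)) ≤
        (A + 1) * (C + 48) * (1 + ‖x‖) ^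
          (-((0 + (Module.finrank ℝ (EuclideanSpace ℝ (Fin 2)) + 1) : ℕ) : ℝ)) := by
      intro x
      rw [weightExp_eq_three']
      calc (C + 48) * (1 + ‖x‖) ^ (-(6 : ℝ)) * ((A + 1) * (1 + ‖x‖))
          = (A + 1) * (C + 48) * ((1 + ‖x‖) ^ 1 * (1 + ‖x‖) ^ (-((1 + 5 : ℕ) : ℝ))) := by
            norm_num; ring
        _ = (A + 1) * (C + 48) * (1 + ‖x‖) ^ (-(5 : ℝ)) := by
            rw [pow_mul_rpow_neg_add' x 1 5]; norm_num
        _ ≤ (A + 1) * (C + 48) * (1 + ‖x‖) ^ (-(3 : ℝ)) := by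
            refine mul_le_mul_of_nonneg_left (rpow_neg_le_rpow_neg_of_le x (by norm_num))
              (by positivity)
    have hφ0' : ∀ x, |φ x| ≤ (A + 1) * (1 + ‖x‖) := fun x =>
      (hφ0 x).trans (by nlinarith [norm_nonneg x])
    have hΘ0 : ∀ x, |Θ x| ≤ (A + 1) * (C + 48) * (1 + ‖x‖) ^
        (-((0 + (Module.finrank ℝ (EuclideanSpace ℝ (Fin 2)) + 1) : ℕ) : ℝ)) := by
      intro x
      refine le_trans ?_ (hK x)
      rw [hΘ, abs_mul]
      have hl : |Real.log (θ x)| ≤ (A + 1) * (1 + ‖x‖) := by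
        have h' : |Real.log (θ x)| ≤ |Real.log (θ x) + 1| + 1 := by
          have h'' := abs_sub (Real.log (θ x) + 1) 1
          simp only [add_sub_cancel_right, abs_one] at h''
          exact h''
        have := hφ0 x
        nlinarith [norm_nonneg x]
      calc |θ x| * |Real.log (θ x)| ≤ (C + 8) * (1 + ‖x‖) ^ (-(6 : ℝ)) * ((A + 1) * (1 + ‖x‖)) :=
            mul_le_mul (hθ0 x) hl (abs_nonneg _) (by positivity)
        _ ≤ (C + 48) * (1 + ‖x‖) ^ (-(6 : ℝ)) * ((A + 1) * (1 + ‖x‖)) := by gcongr; norm_num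
    have hΘ1' : ∀ x, ‖fderiv ℝ Θ x‖ ≤ (A + 1) * (C + 48) * (1 + ‖x‖) ^
        (-((0 + (Module.finrank ℝ (EuclideanSpace ℝ (Fin 2)) + 1) : ℕ) : ℝ)) := by
      intro x
      refine le_trans ?_ (hK x)
      rw [hDΘ x, norm_smul, Real.norm_eq_abs, mul_comm]
      exact mul_le_mul (hθ1 x) (hφ0' x) (abs_nonneg _) (by positivity)
    have key := integral_mul_fderiv_apply_eq_neg_of_decay (v := u t) (θ := Θ) (φ := fun _ => (1 : ℝ))
      hu1 hΘ1 contDiff_const (h.divFree t ht) hM (Cφ := 1) (k := 0) (fun x => by simp)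
      (fun x => by simp [gradient_fun_const]) hΘ0 hΘ1'
    simp only [gradient_fun_const, inner_zero_right, mul_zero, integral_zero, neg_zero, one_mul] at key
    rw [← key]
    refine integral_congr_ae (Eventually.of_forall fun x => ?_)
    simp only [hDΘ x, FunLike.coe_smul, Pi.smul_apply, smul_eq_mul]
  have hT1 : ∫ x, φ x * fderiv ℝ w x (u t x) = -(ε * ∫ x, φ x * fderiv ℝ η x (u t x)) := by
    have e : ∀ x, φ x * fderiv ℝ w x (u t x) =
        φ x * fderiv ℝ θ x (u t x) - ε * (φ x * fderiv ℝ η x (u t x)) := by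
      intro x; rw [hDw]; ring
    have hIθc : Integrable (fun x => φ x * fderiv ℝ θ x (u t x))
        (volume : Measure (EuclideanSpace ℝ (Fin 2))) := by
      have : Integrable (fun x => φ x * fderiv ℝ w x (u t x) + ε * (φ x * fderiv ℝ η x (u t x)))
          (volume : Measure (EuclideanSpace ℝ (Fin 2))) := hIc.add (hIηc.const_mul ε)
      refine this.congr (Eventually.of_forall fun x => ?_)
      show φ x * fderiv ℝ w x (u t x) + ε * (φ x * fderiv ℝ η x (u t x)) = φ x * fderiv ℝ θ x (u t x)
      rw [e x]; ring
    rw [integral_congr_ae (Eventually.of_forall e), integral_sub hIθc (hIηc.const_mul ε),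
      integral_const_mul, hT0, zero_sub]
  -- (b) the viscous term: `∫ φ Δθ = −∫ ‖∇θ‖²/θ` (coordinatewise integration by parts)
  have hT2θ : ∫ x, φ x * (Δ θ) x = -∫ x, ‖fderiv ℝ θ x‖ ^ 2 / θ x := by
    set b := stdOrthonormalBasis ℝ (EuclideanSpace ℝ (Fin 2)) with hb
    have hD2 : ContDiff ℝ 1 (fderiv ℝ θ) := hθ2.fderiv_right (m := 1) (by norm_num)
    have hf : ∀ i x, HasFDerivAt (fun y => fderiv ℝ θ y (b i))
        ((ContinuousLinearMap.apply ℝ ℝ (b i)).comp (fderiv ℝ (fderiv ℝ θ) x)) x :=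
      fun i x => (ContinuousLinearMap.apply ℝ ℝ (b i)).hasFDerivAt.comp x
        (hD2.differentiable (by norm_num) x).hasFDerivAt
    -- the second derivative splits: `D²θ = D²ω + ε D²η`
    have hwd1 : Differentiable ℝ (fderiv ℝ w) :=
      (hw2.fderiv_right (m := 1) (by norm_num)).differentiable (by norm_num)
    have hηd1 : Differentiable ℝ (fderiv ℝ η) :=
      (hηC.fderiv_right (m := ∞) (by simp)).differentiable (by simp)
    have hD2split : ∀ x a c, fderiv ℝ (fderiv ℝ θ) x a c =
        fderiv ℝ (fderiv ℝ w) x a c + ε * fderiv ℝ (fderiv ℝ η) x a c := by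
      intro x a c
      rw [hDθ]
      rw [show (fun x => fderiv ℝ w x + ε • fderiv ℝ η x) = fderiv ℝ w + ε • fderiv ℝ η from rfl,
        fderiv_add (hwd1 x) ((hηd1 x).const_smul ε), fderiv_const_smul (hηd1 x)]
      simp
    have hb1 : ∀ i, ‖b i‖ = 1 := fun i => b.orthonormal.1 i
    -- integrability of the three products
    have hI1 : ∀ i, Integrable (fun x => fderiv ℝ (fderiv ℝ θ) x (b i) (b i) * φ x)
        (volume : Measure (EuclideanSpace ℝ (Fin 2))) := by
      intro i
      have := hIpair (g := fun x => fderiv ℝ (fderiv ℝ θ) x (b i) (b i))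
        ((hD2θc.clm_apply continuous_const).clm_apply continuous_const) (C + 54 * 8)
        (fun x => ?_)
      · exact this.congr (Eventually.of_forall fun x => mul_comm _ _)
      · rw [hD2split]
        refine (abs_add_le _ _).trans ?_
        have e1 : |fderiv ℝ (fderiv ℝ w) x (b i) (b i)| ≤ C * (1 + ‖x‖) ^ (-(6 : ℝ)) := by
          rw [← Real.norm_eq_abs]
          exact ((norm_apply_orthonormalBasis_le b i _).trans
            (norm_apply_orthonormalBasis_le b i _)).trans (h2 x)
        have e2 : |ε * fderiv ℝ (fderiv ℝ η) x (b i) (b i)| ≤ 54 * 8 * (1 + ‖x‖) ^ (-(6 : ℝ)) := by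
          rw [abs_mul, abs_of_pos hε]
          calc ε * |fderiv ℝ (fderiv ℝ η) x (b i) (b i)| ≤ 1 * (54 * η x) :=
                mul_le_mul hε1 (abs_fderiv_fderiv_eta_apply_le x (hb1 i)) (abs_nonneg _) zero_le_one
            _ ≤ 1 * (54 * (8 * (1 + ‖x‖) ^ (-(6 : ℝ)))) := by gcongr; exact eta_le_rpow x
            _ = 54 * 8 * (1 + ‖x‖) ^ (-(6 : ℝ)) := by ring
        linarith
    have hI2 : ∀ i, Integrable (fun x => fderiv ℝ θ x (b i) * fderiv ℝ φ x (b i))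
        (volume : Measure (EuclideanSpace ℝ (Fin 2))) := by
      intro i
      refine Integrable.mono' hFi
        ((hDθc.clm_apply continuous_const).mul
          ((hφ1.continuous_fderiv (by norm_num)).clm_apply continuous_const)).aestronglyMeasurable
        (Eventually.of_forall fun x => ?_)
      rw [norm_mul, Real.norm_eq_abs, Real.norm_eq_abs, hDφ x]
      simp only [FunLike.coe_smul, Pi.smul_apply, smul_eq_mul, abs_mul, abs_inv,
        abs_of_pos (hpos x)]
      have ha : |fderiv ℝ θ x (b i)| ≤ ‖fderiv ℝ θ x‖ := by
        rw [← Real.norm_eq_abs]; exact norm_apply_orthonormalBasis_le b i _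
      calc |fderiv ℝ θ x (b i)| * ((θ x)⁻¹ * |fderiv ℝ θ x (b i)|)
          ≤ ‖fderiv ℝ θ x‖ * ((θ x)⁻¹ * ‖fderiv ℝ θ x‖) := by
            refine mul_le_mul ha (mul_le_mul_of_nonneg_left ha (inv_nonneg.2 (hpos x).le))
              (mul_nonneg (inv_nonneg.2 (hpos x).le) (abs_nonneg _)) (norm_nonneg _)
        _ = ‖fderiv ℝ θ x‖ ^ 2 / θ x := by rw [div_eq_mul_inv]; ring
    have hI3 : ∀ i, Integrable (fun x => fderiv ℝ θ x (b i) * φ x)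
        (volume : Measure (EuclideanSpace ℝ (Fin 2))) := by
      intro i
      have := hIpair (g := fun x => fderiv ℝ θ x (b i)) (hDθc.clm_apply continuous_const) (C + 48)
        fun x => by
          rw [← Real.norm_eq_abs]; exact (norm_apply_orthonormalBasis_le b i _).trans (hθ1 x)
      exact this.congr (Eventually.of_forall fun x => mul_comm _ _)
    -- integration by parts, one coordinate at a time
    have hibp : ∀ i, ∫ x, fderiv ℝ θ x (b i) * fderiv ℝ φ x (b i) =
        -∫ x, fderiv ℝ (fderiv ℝ θ) x (b i) (b i) * φ x := by
      intro i
      exact integral_bilinear_hasFDerivAt_right_eq_neg_left_of_integrable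
        (μ := (volume : Measure (EuclideanSpace ℝ (Fin 2)))) (f := fun y => fderiv ℝ θ y (b i))
        (f' := fun x => (ContinuousLinearMap.apply ℝ ℝ (b i)).comp (fderiv ℝ (fderiv ℝ θ) x))
        (g := φ) (g' := fderiv ℝ φ) (v := b i) (B := ContinuousLinearMap.mul ℝ ℝ)
        (hI1 i) (hI2 i) (hI3 i)
        (fun x _ => hf i x) (fun x _ => (hφ1.differentiable (by norm_num) x).hasFDerivAt)
    -- the pointwise identity `∑ᵢ (∂ᵢθ)(∂ᵢφ) = ‖∇θ‖²/θ`
    have hsum : ∀ x, ∑ i, fderiv ℝ θ x (b i) * fderiv ℝ φ x (b i) = ‖fderiv ℝ θ x‖ ^ 2 / θ x := by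
      intro x
      simp only [hDφ x, FunLike.coe_smul, Pi.smul_apply, smul_eq_mul]
      rw [b.norm_dual, div_eq_mul_inv, Finset.sum_mul]
      exact Finset.sum_congr rfl fun i _ => by ring
    calc ∫ x, φ x * (Δ θ) x
        = ∫ x, ∑ i, fderiv ℝ (fderiv ℝ θ) x (b i) (b i) * φ x := by
          refine integral_congr_ae (Eventually.of_forall fun x => ?_)
          simp only [laplacian_apply_eq_sum_fderiv_fderiv b, Finset.mul_sum]
          exact Finset.sum_congr rfl fun i _ => mul_comm _ _
      _ = ∑ i, ∫ x, fderiv ℝ (fderiv ℝ θ) x (b i) (b i) * φ x :=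
          integral_finsetSum _ fun i _ => hI1 i
      _ = -∑ i, ∫ x, fderiv ℝ θ x (b i) * fderiv ℝ φ x (b i) := by
          rw [← Finset.sum_neg_distrib]
          refine Finset.sum_congr rfl fun i _ => ?_
          rw [hibp i, neg_neg]
      _ = -∫ x, ∑ i, fderiv ℝ θ x (b i) * fderiv ℝ φ x (b i) := by
          rw [integral_finsetSum _ fun i _ => hI2 i]
      _ = -∫ x, ‖fderiv ℝ θ x‖ ^ 2 / θ x := by
          congr 1
          exact integral_congr_ae (Eventually.of_forall hsum)
  have hT2 : ∫ x, φ x * (Δ w) x =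
      -(∫ x, ‖fderiv ℝ θ x‖ ^ 2 / θ x) - ε * ∫ x, φ x * (Δ η) x := by
    have e : ∀ x, φ x * (Δ w) x = φ x * (Δ θ) x - ε * (φ x * (Δ η) x) := by
      intro x; rw [hΔw]; ring
    have hIθΔ : Integrable (fun x => φ x * (Δ θ) x) (volume : Measure (EuclideanSpace ℝ (Fin 2))) := by
      have : Integrable (fun x => φ x * (Δ w) x + ε * (φ x * (Δ η) x))
          (volume : Measure (EuclideanSpace ℝ (Fin 2))) := hIΔ.add (hIηΔ.const_mul ε)
      refine this.congr (Eventually.of_forall fun x => ?_)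
      show φ x * (Δ w) x + ε * (φ x * (Δ η) x) = φ x * (Δ θ) x
      rw [e x]; ring
    rw [integral_congr_ae (Eventually.of_forall e), integral_sub hIθΔ (hIηΔ.const_mul ε),
      integral_const_mul, hT2θ]
  -- (c) assemble
  have e1 : ∫ x, φ x * wt x = ∫ x, -(φ x * fderiv ℝ w x (u t x)) + ν * (φ x * (Δ w) x) :=
    integral_congr_ae (Eventually.of_forall hpt)
  have eres : ∫ x, φ x * (fderiv ℝ η x (u t x) - ν * (Δ η) x) =
      (∫ x, φ x * fderiv ℝ η x (u t x)) - ν * ∫ x, φ x * (Δ η) x := by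
    have e : ∀ x, φ x * (fderiv ℝ η x (u t x) - ν * (Δ η) x) =
        φ x * fderiv ℝ η x (u t x) - ν * (φ x * (Δ η) x) := fun x => by ring
    rw [integral_congr_ae (Eventually.of_forall e), integral_sub hIηc (hIηΔ.const_mul ν),
      integral_const_mul]
  have hIn : Integrable (fun x => -(φ x * fderiv ℝ w x (u t x)))
      (volume : Measure (EuclideanSpace ℝ (Fin 2))) := hIc.neg
  have hIνΔ : Integrable (fun x => ν * (φ x * (Δ w) x))
      (volume : Measure (EuclideanSpace ℝ (Fin 2))) := hIΔ.const_mul ν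
  rw [e1, integral_add hIn hIνΔ, integral_neg, integral_const_mul, hT1, hT2, eres]
  ring

end Balance

section EntropyLaw

variable {S : Set ℝ} {ν : ℝ} {f u : ℝ → EuclideanSpace ℝ (Fin 2) → EuclideanSpace ℝ (Fin 2)}
  {p : ℝ → EuclideanSpace ℝ (Fin 2) → ℝ}

/-! ### §3 The regularised entropy law within a convex set of times -/

/-- **The regularised Boltzmann entropy law.** In the setting of `reg_balance`, on a convex set of
times `D ⊆ S` on which `ω ≥ 0`, the regularised entropy `s ↦ ∫ θ_s log θ_s`, `θ_s = ω(s) + ε η`,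
has within `D` at `t` the derivative `−ν ∫ ‖∇θ_t‖²/θ_t + ε ∫ (log θ_t + 1)(∇η·u(t) − νΔη)`
(differentiation under the integral sign, dominated by the uniform decay of `∂ₜω` against the
linear growth of `log θ + 1`; then §2). [cite: GallayWayne2005, Lemma 3.2 (proof, p. 12)] -/
private theorem reg_hasDerivWithinAt_entropy (h : IsClassicalNSSolutionOn S ν f u p)
    (hU : UniqueDiffOn ℝ S) {D : Set ℝ} (hD : Convex ℝ D) (hDS : D ⊆ S) {t : ℝ}
    (ht : t ∈ D) {M : ℝ} (hM : ∀ x, ‖u t x‖ ≤ M)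
    (hcurl : ∀ x, PlanarEigenmode.vorticity (f t) x = 0)
    (hnn : ∀ s ∈ D, ∀ x, 0 ≤ PlanarEigenmode.vorticity (u s) x) {C : ℝ} (hC : 0 ≤ C)
    (hdec : ∀ s ∈ S, ∀ x, |PlanarEigenmode.vorticity (u s) x| ≤ C * (1 + ‖x‖) ^ (-(6 : ℝ)) ∧
        ‖fderiv ℝ (PlanarEigenmode.vorticity (u s)) x‖ ≤ C * (1 + ‖x‖) ^ (-(6 : ℝ)) ∧
        ‖fderiv ℝ (fderiv ℝ (PlanarEigenmode.vorticity (u s))) x‖ ≤ C * (1 + ‖x‖) ^ (-(6 : ℝ)) ∧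
        |timeDerivWithin S (fun r y => PlanarEigenmode.vorticity (u r) y) s x| ≤
          C * (1 + ‖x‖) ^ (-(6 : ℝ)))
    {ε : ℝ} (hε : 0 < ε) (hε1 : ε ≤ 1) :
    HasDerivWithinAt
      (fun s => ∫ x, (PlanarEigenmode.vorticity (u s) x + ε * (((1 : ℝ) + ‖x‖ ^ 2) ^ 3)⁻¹) *
        Real.log (PlanarEigenmode.vorticity (u s) x + ε * (((1 : ℝ) + ‖x‖ ^ 2) ^ 3)⁻¹))
      (-(ν * ∫ x, ‖fderiv ℝ (fun y => PlanarEigenmode.vorticity (u t) y +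
            ε * (((1 : ℝ) + ‖y‖ ^ 2) ^ 3)⁻¹) x‖ ^ 2 /
            (PlanarEigenmode.vorticity (u t) x + ε * (((1 : ℝ) + ‖x‖ ^ 2) ^ 3)⁻¹)) +
          ε * ∫ x, (Real.log (PlanarEigenmode.vorticity (u t) x + ε * (((1 : ℝ) + ‖x‖ ^ 2) ^ 3)⁻¹) + 1) *
            (fderiv ℝ (fun w : EuclideanSpace ℝ (Fin 2) => (((1 : ℝ) + ‖w‖ ^ 2) ^ 3)⁻¹) x (u t x) -
              ν * (Δ (fun w : EuclideanSpace ℝ (Fin 2) => (((1 : ℝ) + ‖w‖ ^ 2) ^ 3)⁻¹)) x)) D t := by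
  have hsm := PlanarEigenmode.isSmoothSpaceTimeOn_vorticity h.smooth_velocity hU
  set A : ℝ := Real.log (C + 1) + |Real.log ε| + 7 with hA
  have hA0 : 0 ≤ A := by
    have : 0 ≤ Real.log (C + 1) := Real.log_nonneg (by linarith)
    positivity
  -- the regularised slices on `D`
  have hslice : ∀ s ∈ D, ContDiff ℝ 2 (PlanarEigenmode.vorticity (u s)) := fun s hs =>
    contDiff_infty.1 (hsm.contDiff_slice (hDS hs)) 2
  have hreg : ∀ s ∈ D,
      (∀ x, 0 < PlanarEigenmode.vorticity (u s) x + ε * (((1 : ℝ) + ‖x‖ ^ 2) ^ 3)⁻¹) ∧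
      ∀ x, |Real.log (PlanarEigenmode.vorticity (u s) x + ε * (((1 : ℝ) + ‖x‖ ^ 2) ^ 3)⁻¹) + 1| ≤
        A * (1 + ‖x‖) := by
    intro s hs
    obtain ⟨hpos, -, -, -, hlog⟩ := reg_pos_log (hslice s hs) (hnn s hs) hC
      (fun x => (hdec s (hDS hs) x).1) hε hε1
      (θ := fun x => PlanarEigenmode.vorticity (u s) x + ε * (((1 : ℝ) + ‖x‖ ^ 2) ^ 3)⁻¹) rfl
    exact ⟨hpos, hlog⟩
  -- the dominating function
  set bound : EuclideanSpace ℝ (Fin 2) → ℝ := fun x =>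
    A * (1 + ‖x‖) * (C * (1 + ‖x‖) ^ (-(6 : ℝ))) with hbound
  have hbc : Continuous bound := by
    have h1 : Continuous fun x : EuclideanSpace ℝ (Fin 2) => (1 + ‖x‖) := by fun_prop
    exact (continuous_const.mul h1).mul
      (continuous_const.mul (h1.rpow_const fun x => Or.inl (by positivity)))
  have hbi : Integrable bound (volume : Measure (EuclideanSpace ℝ (Fin 2))) := by
    refine integrable_of_norm_le_rpow_neg hbc (C := A * C) (r := 5) (by rw [finrank_two]; norm_num)
      fun x => ?_
    rw [Real.norm_of_nonneg (by positivity), hbound]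
    calc A * (1 + ‖x‖) * (C * (1 + ‖x‖) ^ (-(6 : ℝ)))
        = A * C * ((1 + ‖x‖) ^ 1 * (1 + ‖x‖) ^ (-((1 + 5 : ℕ) : ℝ))) := by norm_num; ring
      _ = A * C * (1 + ‖x‖) ^ (-(5 : ℝ)) := by rw [pow_mul_rpow_neg_add' x 1 5]; norm_num
      _ ≤ A * C * (1 + ‖x‖) ^ (-(5 : ℝ)) := le_rfl
  -- differentiate under the integral sign within `D`
  have hF_meas : ∀ s ∈ D, AEStronglyMeasurable
      (fun x => (PlanarEigenmode.vorticity (u s) x + ε * (((1 : ℝ) + ‖x‖ ^ 2) ^ 3)⁻¹) *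
        Real.log (PlanarEigenmode.vorticity (u s) x + ε * (((1 : ℝ) + ‖x‖ ^ 2) ^ 3)⁻¹))
      (volume : Measure (EuclideanSpace ℝ (Fin 2))) := fun s hs =>
    (Real.continuous_mul_log.comp ((hsm.continuous_slice (hDS hs)).add
      (continuous_const.mul contDiff_eta.continuous))).aestronglyMeasurable
  have hF_int : Integrable
      (fun x => (PlanarEigenmode.vorticity (u t) x + ε * (((1 : ℝ) + ‖x‖ ^ 2) ^ 3)⁻¹) *
        Real.log (PlanarEigenmode.vorticity (u t) x + ε * (((1 : ℝ) + ‖x‖ ^ 2) ^ 3)⁻¹))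
      (volume : Measure (EuclideanSpace ℝ (Fin 2))) :=
    (reg_integrable (hslice t ht) (hnn t ht) hC (fun x => (hdec t (hDS ht) x).1)
      (fun x => (hdec t (hDS ht) x).2.1) hε hε1 rfl).2.2.1
  have h_bound : ∀ s ∈ D, ∀ x,
      ‖(Real.log (PlanarEigenmode.vorticity (u s) x + ε * (((1 : ℝ) + ‖x‖ ^ 2) ^ 3)⁻¹) + 1) *
        timeDerivWithin S (fun r y => PlanarEigenmode.vorticity (u r) y) s x‖ ≤ bound x := by
    intro s hs x
    rw [hbound, norm_mul, Real.norm_eq_abs, Real.norm_eq_abs]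
    exact mul_le_mul ((hreg s hs).2 x) (hdec s (hDS hs) x).2.2.2 (abs_nonneg _) (by positivity)
  have h_diff : ∀ s ∈ D, ∀ x, HasDerivWithinAt
      (fun r => (PlanarEigenmode.vorticity (u r) x + ε * (((1 : ℝ) + ‖x‖ ^ 2) ^ 3)⁻¹) *
        Real.log (PlanarEigenmode.vorticity (u r) x + ε * (((1 : ℝ) + ‖x‖ ^ 2) ^ 3)⁻¹))
      ((Real.log (PlanarEigenmode.vorticity (u s) x + ε * (((1 : ℝ) + ‖x‖ ^ 2) ^ 3)⁻¹) + 1) *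
        timeDerivWithin S (fun r y => PlanarEigenmode.vorticity (u r) y) s x) D s := by
    intro s hs x
    have h1 := ((hsm.hasDerivWithinAt_timeDerivWithin hU (hDS hs) x).mono hDS).add_const
      (ε * (((1 : ℝ) + ‖x‖ ^ 2) ^ 3)⁻¹)
    exact (Real.hasDerivAt_mul_log ((hreg s hs).1 x).ne').comp_hasDerivWithinAt s h1
  have hDer := hasDerivWithinAt_integral_of_dominated_convex hD ht
    (F := fun s x => (PlanarEigenmode.vorticity (u s) x + ε * (((1 : ℝ) + ‖x‖ ^ 2) ^ 3)⁻¹) *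
        Real.log (PlanarEigenmode.vorticity (u s) x + ε * (((1 : ℝ) + ‖x‖ ^ 2) ^ 3)⁻¹))
    (F' := fun s x => (Real.log (PlanarEigenmode.vorticity (u s) x + ε * (((1 : ℝ) + ‖x‖ ^ 2) ^ 3)⁻¹) + 1) *
      timeDerivWithin S (fun r y => PlanarEigenmode.vorticity (u r) y) s x)
    hF_meas hF_int h_bound hbi h_diff
  exact hDer.congr_deriv (reg_balance h hU (hDS ht) hM hcurl (hnn t ht) hC (hdec t (hDS ht)) hε hε1
    (θ := fun x => PlanarEigenmode.vorticity (u t) x + ε * (((1 : ℝ) + ‖x‖ ^ 2) ^ 3)⁻¹) rfl).2.2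

end EntropyLaw

section EntropyIneq

variable {S : Set ℝ} {ν : ℝ} {f u : ℝ → EuclideanSpace ℝ (Fin 2) → EuclideanSpace ℝ (Fin 2)}
  {p : ℝ → EuclideanSpace ℝ (Fin 2) → ℝ}

/-! ### §4 The regularised relative entropy: `H_ε · T` is non-increasing up to `O(ε log ε)` -/

/-- A convex set of times containing two distinct points has unique differentiability. [folklore] -/
private theorem uniqueDiffOn_of_convex_of_lt' (hS : Convex ℝ S) {t₀ t : ℝ} (ht₀ : t₀ ∈ S)
    (ht : t ∈ S) (hlt : t₀ < t) : UniqueDiffOn ℝ S := by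
  refine uniqueDiffOn_convex hS ⟨(t + t₀) / 2, interior_mono (hS.ordConnected.out ht₀ ht) ?_⟩
  rw [interior_Icc]
  exact ⟨by linarith, by linarith⟩

/-- **The regularised relative entropy inequality (Gallay–Wayne's `H(τ) ≤ H(0) e^{−τ}` at level
`ε`).** Classical planar solution on a convex `S`, curl-free force, `u = K₂ ∗ ω`, uniform rapid
decay with the decay package `C` at weight `6`, `ω ≥ 0` on `S ∩ [t₀, ∞)`, `‖u‖ ≤ M` on
`S ∩ [t₀, t]`, `Γ = ∫ ω(t₀) > 0`, `0 < ε ≤ 1`, `T(s) = s − t₀ + t⋆`. With `θ_s = ω(s) + ε η`,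
`Γ_ε = Γ + ε ∫ η`, and the REDUCED regularised relative entropy
`H_ε(s) = ∫ θ_s log θ_s + (∫ ‖x‖² ω(s) + ε ∫ ‖x‖² η)/(4νT(s)) + Γ_ε log(4πνT(s)/Γ_ε)`
(`= ∫ θ_s log(θ_s/g^ε_s)`, `g^ε_s` the spreading Gaussian of mass `Γ_ε`):
`H_ε(t) T(t) ≤ H_ε(t₀) t⋆ + ε (log(C+1) + |log ε| + 7)(6M + 60|ν|)(8 ∫ (1+‖x‖)^{-5}) T(t) (t − t₀)`.
Proof: §3, the moment laws `dΓ/dt = 0`, `d/dt ∫‖x‖²ω = 4νΓ`, and the Stam–Gross inequality for the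
POSITIVE function `θ_s` (`Literature.Analysis.FunctionSpaces.integral_mul_log_le_fisher`) give
`d/ds (H_ε T) ≤ ε T |R_ε| − ε ∫ η ≤ κ_ε`, whence `s ↦ H_ε(s)T(s) − κ_ε s` is non-increasing on
`S ∩ [t₀, t]`. [cite: GallayWayne2005, §3.4 (p. 14, first display); BakryGentilLedoux2014, Prop. 6.2.5] -/
private theorem reg_relEntropy_mul_le (h : IsClassicalNSSolutionOn S ν f u p) (hS : Convex ℝ S)
    (hν : 0 < ν) (hω : HasUniformRapidDecayOn S (fun t x => PlanarEigenmode.vorticity (u t) x))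
    (hBS : ∀ s ∈ S, ∀ x, u s x = biotSavart2D (PlanarEigenmode.vorticity (u s)) x)
    (hcurl : ∀ s ∈ S, ∀ x, PlanarEigenmode.vorticity (f s) x = 0)
    {t₀ t tstar : ℝ} (ht₀ : t₀ ∈ S) (ht : t ∈ S) (hlt : t₀ < t) (htstar : 0 < tstar)
    (hnn : ∀ s ∈ S, t₀ ≤ s → ∀ x, 0 ≤ PlanarEigenmode.vorticity (u s) x)
    (hΓ : 0 < ∫ x, PlanarEigenmode.vorticity (u t₀) x)
    {M : ℝ} (hM : ∀ s ∈ S, t₀ ≤ s → s ≤ t → ∀ x, ‖u s x‖ ≤ M) {C : ℝ} (hC : 0 ≤ C)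
    (hdec : ∀ s ∈ S, ∀ x, |PlanarEigenmode.vorticity (u s) x| ≤ C * (1 + ‖x‖) ^ (-(6 : ℝ)) ∧
        ‖fderiv ℝ (PlanarEigenmode.vorticity (u s)) x‖ ≤ C * (1 + ‖x‖) ^ (-(6 : ℝ)) ∧
        ‖fderiv ℝ (fderiv ℝ (PlanarEigenmode.vorticity (u s))) x‖ ≤ C * (1 + ‖x‖) ^ (-(6 : ℝ)) ∧
        |timeDerivWithin S (fun r y => PlanarEigenmode.vorticity (u r) y) s x| ≤
          C * (1 + ‖x‖) ^ (-(6 : ℝ)))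
    {ε : ℝ} (hε : 0 < ε) (hε1 : ε ≤ 1) :
    ((∫ x, (PlanarEigenmode.vorticity (u t) x + ε * (((1 : ℝ) + ‖x‖ ^ 2) ^ 3)⁻¹) *
        Real.log (PlanarEigenmode.vorticity (u t) x + ε * (((1 : ℝ) + ‖x‖ ^ 2) ^ 3)⁻¹)) +
      ((∫ x, ‖x‖ ^ 2 * PlanarEigenmode.vorticity (u t) x) +
          ε * ∫ x : EuclideanSpace ℝ (Fin 2), ‖x‖ ^ 2 * (((1 : ℝ) + ‖x‖ ^ 2) ^ 3)⁻¹) /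
        (4 * ν * (t - t₀ + tstar)) +
      ((∫ y, PlanarEigenmode.vorticity (u t₀) y) +
          ε * ∫ x : EuclideanSpace ℝ (Fin 2), (((1 : ℝ) + ‖x‖ ^ 2) ^ 3)⁻¹) *
        Real.log (4 * Real.pi * ν * (t - t₀ + tstar) /
          ((∫ y, PlanarEigenmode.vorticity (u t₀) y) +
            ε * ∫ x : EuclideanSpace ℝ (Fin 2), (((1 : ℝ) + ‖x‖ ^ 2) ^ 3)⁻¹))) * (t - t₀ + tstar) ≤
    ((∫ x, (PlanarEigenmode.vorticity (u t₀) x + ε * (((1 : ℝ) + ‖x‖ ^ 2) ^ 3)⁻¹) *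
        Real.log (PlanarEigenmode.vorticity (u t₀) x + ε * (((1 : ℝ) + ‖x‖ ^ 2) ^ 3)⁻¹)) +
      ((∫ x, ‖x‖ ^ 2 * PlanarEigenmode.vorticity (u t₀) x) +
          ε * ∫ x : EuclideanSpace ℝ (Fin 2), ‖x‖ ^ 2 * (((1 : ℝ) + ‖x‖ ^ 2) ^ 3)⁻¹) /
        (4 * ν * tstar) +
      ((∫ y, PlanarEigenmode.vorticity (u t₀) y) +
          ε * ∫ x : EuclideanSpace ℝ (Fin 2), (((1 : ℝ) + ‖x‖ ^ 2) ^ 3)⁻¹) *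
        Real.log (4 * Real.pi * ν * tstar /
          ((∫ y, PlanarEigenmode.vorticity (u t₀) y) +
            ε * ∫ x : EuclideanSpace ℝ (Fin 2), (((1 : ℝ) + ‖x‖ ^ 2) ^ 3)⁻¹))) * tstar +
    ε * ((Real.log (C + 1) + |Real.log ε| + 7) * ((6 * M + 60 * |ν|) *
      (8 * ∫ x : EuclideanSpace ℝ (Fin 2), (1 + ‖x‖) ^ (-(5 : ℝ))))) * (t - t₀ + tstar) * (t - t₀) := by
  have hU : UniqueDiffOn ℝ S := uniqueDiffOn_of_convex_of_lt' hS ht₀ ht hlt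
  have hsm := PlanarEigenmode.isSmoothSpaceTimeOn_vorticity h.smooth_velocity hU
  -- abbreviations
  set η : EuclideanSpace ℝ (Fin 2) → ℝ := fun x => (((1 : ℝ) + ‖x‖ ^ 2) ^ 3)⁻¹ with hηdef
  set Γ : ℝ := ∫ y, PlanarEigenmode.vorticity (u t₀) y with hΓdef
  set mh : ℝ := ∫ x, η x with hmh
  set m₂ : ℝ := ∫ x, ‖x‖ ^ 2 * η x with hm₂
  set Γe : ℝ := Γ + ε * mh with hΓe
  set A : ℝ := Real.log (C + 1) + |Real.log ε| + 7 with hA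
  set I₅ : ℝ := ∫ x : EuclideanSpace ℝ (Fin 2), (1 + ‖x‖) ^ (-(5 : ℝ)) with hI₅
  set K₈ : ℝ := (6 * M + 60 * |ν|) * (8 * I₅) with hK₈
  set κ : ℝ := ε * (A * K₈) * (t - t₀ + tstar) with hκ
  set Sf : ℝ → ℝ := fun s => ∫ x, (PlanarEigenmode.vorticity (u s) x + ε * η x) *
    Real.log (PlanarEigenmode.vorticity (u s) x + ε * η x) with hSf
  set M₂ : ℝ → ℝ := fun s => ∫ x, ‖x‖ ^ 2 * PlanarEigenmode.vorticity (u s) x with hM₂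
  set J : ℝ → ℝ := fun s => ∫ x, ‖fderiv ℝ (fun y => PlanarEigenmode.vorticity (u s) y + ε * η y) x‖ ^ 2 /
    (PlanarEigenmode.vorticity (u s) x + ε * η x) with hJ
  set R : ℝ → ℝ := fun s => ∫ x, (Real.log (PlanarEigenmode.vorticity (u s) x + ε * η x) + 1) *
    (fderiv ℝ η x (u s x) - ν * (Δ η) x) with hR
  set Hred : ℝ → ℝ := fun s => Sf s + (M₂ s + ε * m₂) / (4 * ν * (s - t₀ + tstar)) +
    Γe * Real.log (4 * Real.pi * ν * (s - t₀ + tstar) / Γe) with hHred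
  set G : ℝ → ℝ := fun s => Hred s * (s - t₀ + tstar) - κ * s with hG
  set D : Set ℝ := S ∩ Icc t₀ t with hD
  have hDc : Convex ℝ D := hS.inter (convex_Icc t₀ t)
  have hDS : D ⊆ S := inter_subset_left
  have hTpos : ∀ s ∈ D, 0 < s - t₀ + tstar := fun s hs => by
    have : t₀ ≤ s := hs.2.1; linarith
  have hTle : ∀ s ∈ D, s - t₀ + tstar ≤ t - t₀ + tstar := fun s hs => by
    have : s ≤ t := hs.2.2; linarith
  have hnnD : ∀ s ∈ D, ∀ x, 0 ≤ PlanarEigenmode.vorticity (u s) x := fun s hs => hnn s hs.1 hs.2.1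
  have hMD : ∀ s ∈ D, ∀ x, ‖u s x‖ ≤ M := fun s hs => hM s hs.1 hs.2.1 hs.2.2
  have ht₀D : t₀ ∈ D := ⟨ht₀, le_refl t₀, hlt.le⟩
  have htD : t ∈ D := ⟨ht, hlt.le, le_refl t⟩
  have hM0 : 0 ≤ M := (norm_nonneg _).trans (hMD t htD 0)
  have hA0 : 0 ≤ A := by
    have : 0 ≤ Real.log (C + 1) := Real.log_nonneg (by linarith)
    positivity
  have hη := eta_pos_le_one
  -- conservation of the circulation on `S`
  have hΓs : ∀ s ∈ S, ∫ y, PlanarEigenmode.vorticity (u s) y = Γ := fun s hs =>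
    (h.planarVorticity_moments_eq hS hω hBS hcurl ht₀ hs 0).1
  -- the regularised slices on `D`
  have hslice : ∀ s ∈ D, ContDiff ℝ 2 (PlanarEigenmode.vorticity (u s)) := fun s hs =>
    contDiff_infty.1 (hsm.contDiff_slice (hDS hs)) 2
  have hregD : ∀ s ∈ D,
      (∀ x, 0 < PlanarEigenmode.vorticity (u s) x + ε * η x) ∧
      ContDiff ℝ 1 (fun x => PlanarEigenmode.vorticity (u s) x + ε * η x) ∧
      Integrable (fun x => PlanarEigenmode.vorticity (u s) x + ε * η x)
        (volume : Measure (EuclideanSpace ℝ (Fin 2))) ∧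
      Integrable (fun x => (PlanarEigenmode.vorticity (u s) x + ε * η x) *
        Real.log (PlanarEigenmode.vorticity (u s) x + ε * η x))
        (volume : Measure (EuclideanSpace ℝ (Fin 2))) ∧
      Integrable (fun x => ‖fderiv ℝ (fun y => PlanarEigenmode.vorticity (u s) y + ε * η y) x‖ ^ 2 /
        (PlanarEigenmode.vorticity (u s) x + ε * η x)) (volume : Measure (EuclideanSpace ℝ (Fin 2))) ∧
      (∫ x, (PlanarEigenmode.vorticity (u s) x + ε * η x)) = Γe := by
    intro s hs
    obtain ⟨hpos, hθ2, -, -, -⟩ := reg_pos_log (hslice s hs) (hnnD s hs) hC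
      (fun x => (hdec s (hDS hs) x).1) hε hε1
      (θ := fun x => PlanarEigenmode.vorticity (u s) x + ε * η x) rfl
    obtain ⟨hi, -, hilog, hiF, -, hmass⟩ := reg_integrable (hslice s hs) (hnnD s hs) hC
      (fun x => (hdec s (hDS hs) x).1) (fun x => (hdec s (hDS hs) x).2.1) hε hε1
      (θ := fun x => PlanarEigenmode.vorticity (u s) x + ε * η x) rfl
    refine ⟨hpos, hθ2.of_le (by norm_num), hi, hilog, hiF, ?_⟩
    rw [hmass, hΓs s (hDS hs)]
  have hmh0 : 0 < mh := by
    rw [hmh]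
    have hηi : Integrable η (volume : Measure (EuclideanSpace ℝ (Fin 2))) :=
      (reg_integrable (hslice t htD) (hnnD t htD) hC (fun x => (hdec t (hDS htD) x).1)
        (fun x => (hdec t (hDS htD) x).2.1) hε hε1
        (θ := fun x => PlanarEigenmode.vorticity (u t) x + ε * η x) rfl).2.2.2.2.1
    rw [integral_pos_iff_support_of_nonneg (fun x => (hη x).1.le) hηi]
    have hsupp : Function.support η = univ := by
      ext x; simp only [Function.mem_support, mem_univ, iff_true]; exact (hη x).1.ne'
    rw [hsupp]; simp
  have hΓe0 : 0 < Γe := by rw [hΓe]; positivity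
  -- the residual bound `|R(s)| ≤ A K₈` on `D`
  have hI₅i : Integrable (fun x : EuclideanSpace ℝ (Fin 2) => (1 + ‖x‖) ^ (-(5 : ℝ)))
      (volume : Measure (EuclideanSpace ℝ (Fin 2))) :=
    integrable_one_add_norm (by rw [finrank_two]; norm_num)
  have hRle : ∀ s ∈ D, |R s| ≤ A * K₈ := by
    intro s hs
    obtain ⟨-, hres, -⟩ := reg_balance h hU (hDS hs) (hMD s hs) (hcurl s (hDS hs)) (hnnD s hs) hC
      (hdec s (hDS hs)) hε hε1 (θ := fun x => PlanarEigenmode.vorticity (u s) x + ε * η x) rfl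
    have hb := norm_integral_le_of_norm_le (hI₅i.const_mul (A * (6 * M + 60 * |ν|) * 8))
      (Eventually.of_forall fun x => by
        rw [Real.norm_eq_abs]
        exact (hres x).trans (le_of_eq (by ring)))
    rw [Real.norm_eq_abs, integral_const_mul] at hb
    rw [hR, hK₈, hI₅]
    refine hb.trans (le_of_eq ?_)
    ring
  -- the derivative of `G` within `D` on `D`, and its sign (Stam–Gross)
  have hGd : ∀ s ∈ D, HasDerivWithinAt G
      ((-(ν * J s) + ε * R s +
          ((4 * ν * Γ) * (4 * ν * (s - t₀ + tstar)) - (M₂ s + ε * m₂) * (4 * ν * 1)) /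
            (4 * ν * (s - t₀ + tstar)) ^ 2 +
          Γe * ((4 * Real.pi * ν * 1 / Γe) / (4 * Real.pi * ν * (s - t₀ + tstar) / Γe))) *
        (s - t₀ + tstar) + Hred s * 1 - κ * 1) D s := by
    intro s hs
    have hT := hTpos s hs
    -- the three laws at `s`
    have hSd := reg_hasDerivWithinAt_entropy h hU hDc hDS hs (hMD s hs) (hcurl s (hDS hs))
      hnnD hC hdec hε hε1
    have hM₂d := (h.hasDerivWithinAt_integral_norm_sq_mul_planarVorticity hS hω (hDS hs)
      (hBS s (hDS hs))).mono hDS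
    simp_rw [hcurl s (hDS hs), mul_zero, integral_zero, add_zero] at hM₂d
    rw [hΓs s (hDS hs)] at hM₂d
    have hM₂d' : HasDerivWithinAt (fun r => M₂ r + ε * m₂) (4 * ν * Γ) D s := hM₂d.add_const _
    have hTd : HasDerivWithinAt (fun r => r - t₀ + tstar) 1 D s :=
      ((hasDerivWithinAt_id s D).sub_const t₀).add_const tstar
    have hquot := hM₂d'.div (hTd.const_mul (4 * ν)) (by positivity)
    have hlogd := ((hTd.const_mul (4 * Real.pi * ν)).div_const Γe).log (by positivity)
    have hHd : HasDerivWithinAt Hred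
        (-(ν * J s) + ε * R s +
          ((4 * ν * Γ) * (4 * ν * (s - t₀ + tstar)) - (M₂ s + ε * m₂) * (4 * ν * 1)) /
            (4 * ν * (s - t₀ + tstar)) ^ 2 +
          Γe * ((4 * Real.pi * ν * 1 / Γe) / (4 * Real.pi * ν * (s - t₀ + tstar) / Γe))) D s :=
      (hSd.add hquot).add (hlogd.const_mul Γe)
    have hκd : HasDerivWithinAt (fun r => κ * r) (κ * 1) D s := (hasDerivWithinAt_id s D).const_mul κ
    exact (hHd.mul hTd).sub hκd
  have hGd0 : ∀ s ∈ D,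
      (-(ν * J s) + ε * R s +
          ((4 * ν * Γ) * (4 * ν * (s - t₀ + tstar)) - (M₂ s + ε * m₂) * (4 * ν * 1)) /
            (4 * ν * (s - t₀ + tstar)) ^ 2 +
          Γe * ((4 * Real.pi * ν * 1 / Γe) / (4 * Real.pi * ν * (s - t₀ + tstar) / Γe))) *
        (s - t₀ + tstar) + Hred s * 1 - κ * 1 ≤ 0 := by
    intro s hs
    have hT := hTpos s hs
    obtain ⟨hpos, hθ1, hi, hilog, hiF, hmass⟩ := hregD s hs
    -- the Stam–Gross inequality for `θ_s` at `τ = νT(s)`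
    have hLSI := Literature.Analysis.FunctionSpaces.integral_mul_log_le_fisher hθ1 hpos hi hilog hiF
      (by rw [hmass]; exact hΓe0) (τ := ν * (s - t₀ + tstar)) (by positivity)
    beta_reduce at hLSI
    rw [hmass] at hLSI
    have hn : ((2 : ℕ) : ℝ) + ((2 : ℕ) : ℝ) / 2 * Real.log (4 * Real.pi * (ν * (s - t₀ + tstar))) =
        2 + Real.log (4 * Real.pi * (ν * (s - t₀ + tstar))) := by norm_num
    rw [hn] at hLSI
    have hlog4 : Real.log (4 * Real.pi * ν * (s - t₀ + tstar) / Γe) =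
        Real.log (4 * Real.pi * (ν * (s - t₀ + tstar))) - Real.log Γe := by
      rw [Real.log_div (by positivity) hΓe0.ne']; ring_nf
    have e : (-(ν * J s) + ε * R s +
          ((4 * ν * Γ) * (4 * ν * (s - t₀ + tstar)) - (M₂ s + ε * m₂) * (4 * ν * 1)) /
            (4 * ν * (s - t₀ + tstar)) ^ 2 +
          Γe * ((4 * Real.pi * ν * 1 / Γe) / (4 * Real.pi * ν * (s - t₀ + tstar) / Γe))) *
        (s - t₀ + tstar) + Hred s * 1 - κ * 1 =
        Sf s + Γ + Γe + Γe * Real.log (4 * Real.pi * ν * (s - t₀ + tstar) / Γe) -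
          ν * (s - t₀ + tstar) * J s + ε * (s - t₀ + tstar) * R s - κ := by
      rw [hHred]
      field_simp
      ring
    have hSf_le : Sf s ≤ ν * (s - t₀ + tstar) * J s -
        Γe * (2 + Real.log (4 * Real.pi * (ν * (s - t₀ + tstar)))) + Γe * Real.log Γe := by
      simp only [hSf, hJ]
      linarith
    rw [e, hlog4]
    have hRs : R s ≤ A * K₈ := (le_abs_self _).trans (hRle s hs)
    have hprod : ε * (s - t₀ + tstar) * R s ≤ κ := by
      rw [hκ]
      calc ε * (s - t₀ + tstar) * R s ≤ ε * (s - t₀ + tstar) * (A * K₈) :=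
            mul_le_mul_of_nonneg_left hRs (by positivity)
        _ ≤ ε * (t - t₀ + tstar) * (A * K₈) := by
            have hK0 : 0 ≤ A * K₈ := by
              have := (abs_nonneg _).trans (hRle s hs); exact this
            exact mul_le_mul_of_nonneg_right (mul_le_mul_of_nonneg_left (hTle s hs) hε.le) hK0
        _ = ε * (A * K₈) * (t - t₀ + tstar) := by ring
    have hmh' : 0 ≤ ε * mh := by positivity
    have hΓe' : Γe = Γ + ε * mh := hΓe
    linarith [hSf_le, hprod, hmh', hΓe']
  -- `G` is non-increasing on `D`
  have hGanti : AntitoneOn G D := by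
    refine antitoneOn_of_hasDerivWithinAt_nonpos hDc
      (fun s hs => (hGd s hs).continuousWithinAt)
      (fun s hs => (hGd s (interior_subset hs)).mono interior_subset) fun s hs =>
      hGd0 s (interior_subset hs)
  -- unfold `G` at `t` and `t₀`
  have hGle : Hred t * (t - t₀ + tstar) - κ * t ≤ Hred t₀ * tstar - κ * t₀ := by
    have h' := hGanti ht₀D htD hlt.le
    change Hred t * (t - t₀ + tstar) - κ * t ≤ Hred t₀ * (t₀ - t₀ + tstar) - κ * t₀ at h'
    simp only [sub_self, zero_add] at h'
    exact h'
  have hκ' : κ * t - κ * t₀ = ε * (A * K₈) * (t - t₀ + tstar) * (t - t₀) := by rw [hκ]; ring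
  have e4 : Hred t₀ = Sf t₀ + (M₂ t₀ + ε * m₂) / (4 * ν * tstar) +
      Γe * Real.log (4 * Real.pi * ν * tstar / Γe) := by
    simp only [hHred, sub_self, zero_add]
  change Hred t * (t - t₀ + tstar) ≤
    (Sf t₀ + (M₂ t₀ + ε * m₂) / (4 * ν * tstar) + Γe * Real.log (4 * Real.pi * ν * tstar / Γe)) *
        tstar + ε * (A * K₈) * (t - t₀ + tstar) * (t - t₀)
  rw [← e4]
  linarith [hGle, hκ']

end EntropyIneq

section Limit

variable {S : Set ℝ} {ν : ℝ} {f u : ℝ → EuclideanSpace ℝ (Fin 2) → EuclideanSpace ℝ (Fin 2)}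
  {p : ℝ → EuclideanSpace ℝ (Fin 2) → ℝ}

/-! ### §5 Removing the regularisation: `ε → 0⁺` -/

/-- `|s log s| ≤ 2 √s + s²` for `s ≥ 0`. [folklore] -/
private theorem abs_mul_log_le {s : ℝ} (hs : 0 ≤ s) : |s * Real.log s| ≤ 2 * Real.sqrt s + s ^ 2 := by
  rcases le_or_gt s 1 with hs1 | hs1
  · rcases eq_or_lt_of_le hs with h0 | hpos
    · rw [← h0]; simp
    have hr : 0 < Real.sqrt s := Real.sqrt_pos.2 hpos
    have hr1 : Real.sqrt s ≤ 1 := by rw [← Real.sqrt_one]; exact Real.sqrt_le_sqrt hs1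
    have hrs : Real.sqrt s ^ 2 = s := Real.sq_sqrt hs
    have e : s * Real.log s = 2 * Real.sqrt s * (Real.log (Real.sqrt s) * Real.sqrt s) := by
      conv_lhs => rw [← hrs]
      rw [Real.log_pow]; push_cast; ring
    rw [e, abs_mul, abs_of_nonneg (by positivity : (0 : ℝ) ≤ 2 * Real.sqrt s)]
    have hkey : |Real.log (Real.sqrt s) * Real.sqrt s| ≤ 1 :=
      (Real.abs_log_mul_self_lt _ hr hr1).le
    nlinarith [hkey, hr.le, sq_nonneg s, abs_nonneg (Real.log (Real.sqrt s) * Real.sqrt s)]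
  · have hlog0 : 0 ≤ Real.log s := Real.log_nonneg hs1.le
    have hlog1 : Real.log s ≤ s - 1 := Real.log_le_sub_one_of_pos (by linarith)
    rw [abs_of_nonneg (mul_nonneg hs hlog0)]
    nlinarith [mul_le_mul_of_nonneg_left hlog1 hs, Real.sqrt_nonneg s]

/-- `√((1 + ‖x‖)^{-6}) = (1 + ‖x‖)^{-3}`. [folklore] -/
private theorem sqrt_rpow_neg_six (x : EuclideanSpace ℝ (Fin 2)) :
    Real.sqrt ((1 + ‖x‖) ^ (-(6 : ℝ))) = (1 + ‖x‖) ^ (-(3 : ℝ)) := by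
  have h0 : (0 : ℝ) ≤ 1 + ‖x‖ := by positivity
  rw [show (-(6 : ℝ)) = -(3 : ℝ) * 2 by norm_num, Real.rpow_mul h0,
    show ((1 + ‖x‖) ^ (-(3 : ℝ))) ^ (2 : ℝ) = ((1 + ‖x‖) ^ (-(3 : ℝ))) ^ ((2 : ℕ) : ℝ) by norm_num,
    Real.rpow_natCast, Real.sqrt_sq (Real.rpow_nonneg h0 _)]

/-- The dominating function of the family `θ_ε log θ_ε`, `0 < ε ≤ 1`: for `0 ≤ w ≤ C(1+‖x‖)^{-6}`,
`|θ log θ| ≤ 2√(C+8) (1+‖x‖)^{-3} + (C+8)² (1+‖x‖)^{-6}` where `θ = w + ε η`; and the bound is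
integrable on `ℝ²`. [folklore] -/
private theorem reg_mul_log_dominated {C : ℝ} (hC : 0 ≤ C) :
    Integrable (fun x : EuclideanSpace ℝ (Fin 2) =>
        2 * Real.sqrt (C + 8) * (1 + ‖x‖) ^ (-(3 : ℝ)) + (C + 8) ^ 2 * (1 + ‖x‖) ^ (-(6 : ℝ)))
      (volume : Measure (EuclideanSpace ℝ (Fin 2))) ∧
    ∀ (x : EuclideanSpace ℝ (Fin 2)) (a ε : ℝ), 0 ≤ a → |a| ≤ C * (1 + ‖x‖) ^ (-(6 : ℝ)) →
      0 ≤ ε → ε ≤ 1 →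
      |(a + ε * (((1 : ℝ) + ‖x‖ ^ 2) ^ 3)⁻¹) * Real.log (a + ε * (((1 : ℝ) + ‖x‖ ^ 2) ^ 3)⁻¹)| ≤
        2 * Real.sqrt (C + 8) * (1 + ‖x‖) ^ (-(3 : ℝ)) + (C + 8) ^ 2 * (1 + ‖x‖) ^ (-(6 : ℝ)) := by
  have hη := eta_pos_le_one
  refine ⟨?_, fun x a ε ha haC hε0 hε1 => ?_⟩
  · refine Integrable.add ?_ ?_
    · exact (integrable_one_add_norm (by rw [finrank_two]; norm_num)).const_mul _
    · exact (integrable_one_add_norm (by rw [finrank_two]; norm_num)).const_mul _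
  · have hw6 : (0 : ℝ) ≤ (1 + ‖x‖) ^ (-(6 : ℝ)) := Real.rpow_nonneg (by positivity) _
    have hθ0 : 0 ≤ a + ε * (((1 : ℝ) + ‖x‖ ^ 2) ^ 3)⁻¹ := by nlinarith [(hη x).1]
    have hθle : a + ε * (((1 : ℝ) + ‖x‖ ^ 2) ^ 3)⁻¹ ≤ (C + 8) * (1 + ‖x‖) ^ (-(6 : ℝ)) := by
      have h1 : a ≤ C * (1 + ‖x‖) ^ (-(6 : ℝ)) := (le_abs_self a).trans haC
      have h2 : ε * (((1 : ℝ) + ‖x‖ ^ 2) ^ 3)⁻¹ ≤ 1 * (8 * (1 + ‖x‖) ^ (-(6 : ℝ))) :=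
        mul_le_mul hε1 (eta_le_rpow x) (hη x).1.le zero_le_one
      linarith
    have hθle' : a + ε * (((1 : ℝ) + ‖x‖ ^ 2) ^ 3)⁻¹ ≤ C + 8 :=
      hθle.trans (mul_le_of_le_one_right (by linarith) (rpow_neg_le_one x (by norm_num)))
    refine (abs_mul_log_le hθ0).trans (add_le_add ?_ ?_)
    · rw [mul_assoc]
      refine mul_le_mul_of_nonneg_left ?_ (by norm_num)
      calc Real.sqrt (a + ε * (((1 : ℝ) + ‖x‖ ^ 2) ^ 3)⁻¹)
          ≤ Real.sqrt ((C + 8) * (1 + ‖x‖) ^ (-(6 : ℝ))) := Real.sqrt_le_sqrt hθle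
        _ = Real.sqrt (C + 8) * (1 + ‖x‖) ^ (-(3 : ℝ)) := by
            rw [Real.sqrt_mul (by linarith), sqrt_rpow_neg_six]
    · calc (a + ε * (((1 : ℝ) + ‖x‖ ^ 2) ^ 3)⁻¹) ^ 2
          = (a + ε * (((1 : ℝ) + ‖x‖ ^ 2) ^ 3)⁻¹) * (a + ε * (((1 : ℝ) + ‖x‖ ^ 2) ^ 3)⁻¹) := sq _
        _ ≤ (C + 8) * ((C + 8) * (1 + ‖x‖) ^ (-(6 : ℝ))) := mul_le_mul hθle' hθle hθ0 (by linarith)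
        _ = (C + 8) ^ 2 * (1 + ‖x‖) ^ (-(6 : ℝ)) := by ring

/-- **The limit `ε → 0⁺` of the reduced regularised relative entropy at a fixed time.** For
`0 ≤ w ≤ C(1+‖x‖)^{-6}` continuous on `ℝ²`, reals `m₂, mh, M₂` and `Γ, ν, T > 0`:
`∫ θ_ε log θ_ε + (M₂ + ε m₂)/(4νT) + (Γ + ε mh) log(4πνT/(Γ + ε mh)) → ∫ w log w + M₂/(4νT)
+ Γ log(4πνT/Γ)` as `ε → 0⁺` (dominated convergence with the bound `2√θ + θ²`). [folklore] -/
private theorem tendsto_reg_relEntropyRed {w : EuclideanSpace ℝ (Fin 2) → ℝ} (hwc : Continuous w)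
    (hnn : ∀ x, 0 ≤ w x) {C : ℝ} (hC : 0 ≤ C) (h0 : ∀ x, |w x| ≤ C * (1 + ‖x‖) ^ (-(6 : ℝ)))
    {Γ ν T : ℝ} (hΓ : 0 < Γ) (hν : 0 < ν) (hT : 0 < T) (m₂ mh M₂ : ℝ) :
    Tendsto (fun ε : ℝ =>
        (∫ x, (w x + ε * (((1 : ℝ) + ‖x‖ ^ 2) ^ 3)⁻¹) *
            Real.log (w x + ε * (((1 : ℝ) + ‖x‖ ^ 2) ^ 3)⁻¹)) +
          (M₂ + ε * m₂) / (4 * ν * T) + (Γ + ε * mh) * Real.log (4 * Real.pi * ν * T / (Γ + ε * mh)))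
      (𝓝[>] 0)
      (𝓝 ((∫ x, w x * Real.log (w x)) + M₂ / (4 * ν * T) + Γ * Real.log (4 * Real.pi * ν * T / Γ))) := by
  obtain ⟨hbi, hbd⟩ := reg_mul_log_dominated hC
  have hη := eta_pos_le_one
  -- (a) the entropy integral: dominated convergence
  have hSf : Tendsto (fun ε : ℝ => ∫ x, (w x + ε * (((1 : ℝ) + ‖x‖ ^ 2) ^ 3)⁻¹) *
      Real.log (w x + ε * (((1 : ℝ) + ‖x‖ ^ 2) ^ 3)⁻¹)) (𝓝[>] 0)
      (𝓝 (∫ x, w x * Real.log (w x))) := by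
    have hmem : Ioc (0 : ℝ) 1 ∈ 𝓝[>] (0 : ℝ) := Ioc_mem_nhdsGT zero_lt_one
    refine tendsto_integral_filter_of_dominated_convergence
      (fun x => 2 * Real.sqrt (C + 8) * (1 + ‖x‖) ^ (-(3 : ℝ)) + (C + 8) ^ 2 * (1 + ‖x‖) ^ (-(6 : ℝ)))
      (Eventually.of_forall fun ε => ?_) ?_ hbi (Eventually.of_forall fun x => ?_)
    · exact (Real.continuous_mul_log.comp (hwc.add (continuous_const.mul
        contDiff_eta.continuous))).aestronglyMeasurable
    · filter_upwards [hmem] with ε hε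
      exact Eventually.of_forall fun x => by
        rw [Real.norm_eq_abs]; exact hbd x (w x) ε (hnn x) (h0 x) hε.1.le hε.2
    · have hc : Continuous (fun ε : ℝ => (w x + ε * (((1 : ℝ) + ‖x‖ ^ 2) ^ 3)⁻¹) *
          Real.log (w x + ε * (((1 : ℝ) + ‖x‖ ^ 2) ^ 3)⁻¹)) :=
        Real.continuous_mul_log.comp (continuous_const.add (continuous_id.mul continuous_const))
      have := hc.tendsto 0
      simp only [zero_mul, add_zero] at this
      exact tendsto_nhdsWithin_of_tendsto_nhds this
  -- (b) the moment term and (c) the Gaussian normalisation: continuity at `ε = 0`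
  have hM₂ : Tendsto (fun ε : ℝ => (M₂ + ε * m₂) / (4 * ν * T)) (𝓝[>] 0) (𝓝 (M₂ / (4 * ν * T))) := by
    have hc : Continuous (fun ε : ℝ => (M₂ + ε * m₂) / (4 * ν * T)) := by fun_prop
    have := hc.tendsto 0
    simp only [zero_mul, add_zero] at this
    exact tendsto_nhdsWithin_of_tendsto_nhds this
  have hG : Tendsto (fun ε : ℝ => (Γ + ε * mh) * Real.log (4 * Real.pi * ν * T / (Γ + ε * mh)))
      (𝓝[>] 0) (𝓝 (Γ * Real.log (4 * Real.pi * ν * T / Γ))) := by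
    have h1 : Tendsto (fun ε : ℝ => Γ + ε * mh) (𝓝 0) (𝓝 Γ) := by
      have hc : Continuous (fun ε : ℝ => Γ + ε * mh) := by fun_prop
      have := hc.tendsto 0
      simpa using this
    have h2 : Tendsto (fun ε : ℝ => 4 * Real.pi * ν * T / (Γ + ε * mh)) (𝓝 0)
        (𝓝 (4 * Real.pi * ν * T / Γ)) := tendsto_const_nhds.div h1 hΓ.ne'
    have h3 := h1.mul (h2.log (by positivity))
    exact tendsto_nhdsWithin_of_tendsto_nhds h3
  exact (hSf.add hM₂).add hG

/-- `ε (A₀ + |log ε| + 7) K B₁ B₂ → 0` as `ε → 0⁺`. [folklore] -/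
private theorem tendsto_eps_log_eps (A₀ K B₁ B₂ : ℝ) :
    Tendsto (fun ε : ℝ => ε * ((A₀ + |Real.log ε| + 7) * K) * B₁ * B₂) (𝓝[>] 0) (𝓝 0) := by
  have h1 : Tendsto (fun ε : ℝ => |Real.log ε| * ε) (𝓝[>] 0) (𝓝 0) := by
    have h := (tendsto_log_mul_rpow_nhdsGT_zero zero_lt_one).abs
    rw [abs_zero] at h
    refine h.congr' ?_
    filter_upwards [self_mem_nhdsWithin] with ε hε
    rw [Real.rpow_one, abs_mul, abs_of_pos (show (0 : ℝ) < ε from hε)]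
  have h2 : Tendsto (fun ε : ℝ => ε) (𝓝[>] 0) (𝓝 0) :=
    tendsto_nhdsWithin_of_tendsto_nhds tendsto_id
  have h3 : Tendsto (fun ε : ℝ => (ε * (A₀ + 7) + |Real.log ε| * ε) * K * B₁ * B₂) (𝓝[>] 0)
      (𝓝 ((0 * (A₀ + 7) + 0) * K * B₁ * B₂)) :=
    ((((h2.mul_const _).add h1).mul_const K).mul_const B₁).mul_const B₂
  rw [zero_mul, zero_add, zero_mul, zero_mul, zero_mul] at h3
  refine h3.congr' (Eventually.of_forall fun ε => by ring)

end Limit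

section Main

variable {S : Set ℝ} {ν : ℝ} {f u : ℝ → EuclideanSpace ℝ (Fin 2) → EuclideanSpace ℝ (Fin 2)}
  {p : ℝ → EuclideanSpace ℝ (Fin 2) → ℝ}

/-! ### §6 Gallay–Wayne's Lemma 3.2 and §3.4 for NON-NEGATIVE vorticity -/

/-- The Gaussian integral on `ℝ²`: `∫ exp(−‖x‖²/(4νT)) dx = 4πνT` (`ν, T > 0`), and integrability.
[folklore] -/
private theorem integral_exp_neg_sq_div' {ν T : ℝ} (hν : 0 < ν) (hT : 0 < T) :
    Integrable (fun x : EuclideanSpace ℝ (Fin 2) => Real.exp (-(‖x‖ ^ 2 / (4 * ν * T))))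
        (volume : Measure (EuclideanSpace ℝ (Fin 2))) ∧
      ∫ x : EuclideanSpace ℝ (Fin 2), Real.exp (-(‖x‖ ^ 2 / (4 * ν * T))) = 4 * Real.pi * ν * T := by
  have hb : (0 : ℝ) < (4 * ν * T)⁻¹ := by positivity
  have h := GaussianFourier.integral_rexp_neg_mul_sq_norm (V := EuclideanSpace ℝ (Fin 2)) hb
  have e : (fun x : EuclideanSpace ℝ (Fin 2) => Real.exp (-(‖x‖ ^ 2 / (4 * ν * T)))) =
      fun x => Real.exp (-(4 * ν * T)⁻¹ * ‖x‖ ^ 2) := by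
    funext x; congr 1; rw [div_eq_inv_mul, neg_mul]
  rw [finrank_euclideanSpace_fin] at h
  have hval : (Real.pi / (4 * ν * T)⁻¹) ^ ((2 : ℕ) / 2 : ℝ) = 4 * Real.pi * ν * T := by
    rw [show ((2 : ℕ) / 2 : ℝ) = 1 by norm_num, Real.rpow_one, div_inv_eq_mul]; ring
  rw [hval] at h
  rw [e]
  refine ⟨?_, h⟩
  by_contra hni
  rw [integral_undef hni] at h
  have : (0 : ℝ) < 4 * Real.pi * ν * T := by positivity
  linarith

/-- The spreading Gaussian of mass `Γ`: positivity, integrability, `∫ g = Γ`, and its logarithm.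
[folklore] -/
private theorem gaussian_facts' {Γ ν T : ℝ} (hΓ : 0 < Γ) (hν : 0 < ν) (hT : 0 < T) :
    (∀ x : EuclideanSpace ℝ (Fin 2), 0 < Γ / (4 * Real.pi * ν * T) * Real.exp (-(‖x‖ ^ 2 / (4 * ν * T)))) ∧
      Integrable (fun x : EuclideanSpace ℝ (Fin 2) =>
        Γ / (4 * Real.pi * ν * T) * Real.exp (-(‖x‖ ^ 2 / (4 * ν * T))))
        (volume : Measure (EuclideanSpace ℝ (Fin 2))) ∧
      (∫ x : EuclideanSpace ℝ (Fin 2), Γ / (4 * Real.pi * ν * T) * Real.exp (-(‖x‖ ^ 2 / (4 * ν * T))) = Γ) ∧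
      ∀ x : EuclideanSpace ℝ (Fin 2),
        Real.log (Γ / (4 * Real.pi * ν * T) * Real.exp (-(‖x‖ ^ 2 / (4 * ν * T)))) =
          Real.log (Γ / (4 * Real.pi * ν * T)) - ‖x‖ ^ 2 / (4 * ν * T) := by
  obtain ⟨hi, hval⟩ := integral_exp_neg_sq_div' hν hT
  have hc : 0 < Γ / (4 * Real.pi * ν * T) := by positivity
  refine ⟨fun x => mul_pos hc (Real.exp_pos _), hi.const_mul _, ?_, fun x => ?_⟩
  · rw [integral_const_mul, hval]; field_simp
  · rw [Real.log_mul hc.ne' (Real.exp_pos _).ne', Real.log_exp]; ring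

/-- **Splitting the relative entropy with respect to a Gaussian** (no sign condition; Lean's
conventions `log 0 = 0`, `log x = log |x|`). For `w` on `ℝ²` with `w`, `‖x‖² w`, `w log w ∈ L¹`,
and the Gaussian `g = Γ (4πνT)⁻¹ e^{−‖x‖²/(4νT)}` (`Γ, ν, T > 0`): `w log (w/g) ∈ L¹` and
`∫ w log (w/g) = ∫ w log w + (∫ ‖x‖² w)/(4νT) + log(4πνT/Γ) ∫ w`. [folklore] -/
private theorem integral_mul_log_div_gaussian_eq_of_integrable {w : EuclideanSpace ℝ (Fin 2) → ℝ}
    (hi : Integrable w (volume : Measure (EuclideanSpace ℝ (Fin 2))))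
    (hi2 : Integrable (fun x => ‖x‖ ^ 2 * w x) (volume : Measure (EuclideanSpace ℝ (Fin 2))))
    (hilog : Integrable (fun x => w x * Real.log (w x)) (volume : Measure (EuclideanSpace ℝ (Fin 2))))
    {Γ ν T : ℝ} (hΓ : 0 < Γ) (hν : 0 < ν) (hT : 0 < T) :
    Integrable (fun x => w x * Real.log (w x /
        (Γ / (4 * Real.pi * ν * T) * Real.exp (-(‖x‖ ^ 2 / (4 * ν * T))))))
        (volume : Measure (EuclideanSpace ℝ (Fin 2))) ∧
      ∫ x, w x * Real.log (w x / (Γ / (4 * Real.pi * ν * T) * Real.exp (-(‖x‖ ^ 2 / (4 * ν * T))))) =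
        (∫ x, w x * Real.log (w x)) + (∫ x, ‖x‖ ^ 2 * w x) / (4 * ν * T) +
          Real.log (4 * Real.pi * ν * T / Γ) * ∫ x, w x := by
  obtain ⟨hgpos, -, -, hlogg⟩ := gaussian_facts' hΓ hν hT
  have hpt : ∀ x, w x * Real.log (w x /
      (Γ / (4 * Real.pi * ν * T) * Real.exp (-(‖x‖ ^ 2 / (4 * ν * T))))) =
      w x * Real.log (w x) + (‖x‖ ^ 2 * w x) / (4 * ν * T) +
        Real.log (4 * Real.pi * ν * T / Γ) * w x := by
    intro x
    by_cases hx : w x = 0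
    · rw [hx]; simp
    rw [Real.log_div hx (hgpos x).ne', hlogg x]
    have e : Real.log (4 * Real.pi * ν * T / Γ) = -Real.log (Γ / (4 * Real.pi * ν * T)) := by
      rw [← Real.log_inv, inv_div]
    rw [e]
    ring
  have hI : Integrable (fun x => w x * Real.log (w x) + (‖x‖ ^ 2 * w x) / (4 * ν * T) +
      Real.log (4 * Real.pi * ν * T / Γ) * w x) (volume : Measure (EuclideanSpace ℝ (Fin 2))) :=
    (hilog.add (hi2.div_const _)).add (hi.const_mul _)
  refine ⟨hI.congr (Eventually.of_forall fun x => (hpt x).symm), ?_⟩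
  rw [integral_congr_ae (Eventually.of_forall hpt)]
  have i1 : Integrable (fun x => (‖x‖ ^ 2 * w x) / (4 * ν * T))
      (volume : Measure (EuclideanSpace ℝ (Fin 2))) := hi2.div_const _
  have i2 : Integrable (fun x => Real.log (4 * Real.pi * ν * T / Γ) * w x)
      (volume : Measure (EuclideanSpace ℝ (Fin 2))) := hi.const_mul _
  have i3 : Integrable (fun x => w x * Real.log (w x) + (‖x‖ ^ 2 * w x) / (4 * ν * T))
      (volume : Measure (EuclideanSpace ℝ (Fin 2))) := hilog.add i1
  rw [integral_add i3 i2, integral_add hilog i1, integral_div, integral_const_mul]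

/-- The vorticity slice of a classical planar solution is `C¹` (no unique differentiability of the
time set needed). [folklore] -/
private theorem contDiff_planarVorticity_slice' (h : IsClassicalNSSolutionOn S ν f u p) {s : ℝ}
    (hs : s ∈ S) : ContDiff ℝ 1 (PlanarEigenmode.vorticity (u s)) := by
  have hu2 : ContDiff ℝ 2 (u s) := contDiff_infty.1 (h.contDiff_velocity hs) 2
  have hD : ContDiff ℝ 1 (fderiv ℝ (u s)) := hu2.fderiv_right (m := 1) (by norm_num)
  have e : PlanarEigenmode.vorticity (u s) = fun z =>
      fderiv ℝ (u s) z (EuclideanSpace.single 0 1) 1 - fderiv ℝ (u s) z (EuclideanSpace.single 1 1) 0 := rfl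
  rw [e]
  exact (contDiff_euclidean.1 (hD.clm_apply contDiff_const) 1).sub
    (contDiff_euclidean.1 (hD.clm_apply contDiff_const) 0)

/-- The slice toolkit of a non-negative vorticity with the decay package `C` at weight `6`:
`ω(s)` is continuous, integrable, `‖x‖² ω(s)`, `ω log ω ∈ L¹`, and `|ω(s)| ≤ C`. [folklore] -/
private theorem slice_nonneg (h : IsClassicalNSSolutionOn S ν f u p)
    {C : ℝ} (hC : 0 ≤ C) {s : ℝ} (hs : s ∈ S)
    (hdec : ∀ x, |PlanarEigenmode.vorticity (u s) x| ≤ C * (1 + ‖x‖) ^ (-(6 : ℝ)))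
    (hnn : ∀ x, 0 ≤ PlanarEigenmode.vorticity (u s) x) :
    Continuous (PlanarEigenmode.vorticity (u s)) ∧
      Integrable (PlanarEigenmode.vorticity (u s)) (volume : Measure (EuclideanSpace ℝ (Fin 2))) ∧
      Integrable (fun x => ‖x‖ ^ 2 * PlanarEigenmode.vorticity (u s) x)
        (volume : Measure (EuclideanSpace ℝ (Fin 2))) ∧
      Integrable (fun x => PlanarEigenmode.vorticity (u s) x * Real.log (PlanarEigenmode.vorticity (u s) x))
        (volume : Measure (EuclideanSpace ℝ (Fin 2))) ∧
      ∀ x, |PlanarEigenmode.vorticity (u s) x| ≤ C := by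
  set w : EuclideanSpace ℝ (Fin 2) → ℝ := PlanarEigenmode.vorticity (u s) with hw
  have hwc : Continuous w := (contDiff_planarVorticity_slice' h hs).continuous
  have hwi : Integrable w (volume : Measure (EuclideanSpace ℝ (Fin 2))) :=
    integrable_of_norm_le_rpow_neg hwc (C := C) (r := 6) (by rw [finrank_two]; norm_num)
      fun x => by rw [Real.norm_eq_abs]; exact hdec x
  obtain ⟨hbi, hbd⟩ := reg_mul_log_dominated hC
  refine ⟨hwc, hwi, ?_, ?_, fun x => ?_⟩
  · refine integrable_of_norm_le_rpow_neg ((continuous_norm.pow 2).mul hwc) (C := C) (r := 4)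
      (by rw [finrank_two]; norm_num) fun x => ?_
    rw [norm_mul, norm_pow, norm_norm, Real.norm_eq_abs]
    have h2 : ‖x‖ ^ 2 ≤ (1 + ‖x‖) ^ 2 := by gcongr; linarith [norm_nonneg x]
    calc ‖x‖ ^ 2 * |w x| ≤ (1 + ‖x‖) ^ 2 * (C * (1 + ‖x‖) ^ (-(6 : ℝ))) :=
          mul_le_mul h2 (hdec x) (abs_nonneg _) (by positivity)
      _ = C * ((1 + ‖x‖) ^ 2 * (1 + ‖x‖) ^ (-((2 + 4 : ℕ) : ℝ))) := by norm_num; ring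
      _ = C * (1 + ‖x‖) ^ (-(4 : ℝ)) := by rw [pow_mul_rpow_neg_add' x 2 4]; norm_num
  · refine Integrable.mono' hbi (Real.continuous_mul_log.comp hwc).aestronglyMeasurable
      (Eventually.of_forall fun x => ?_)
    have hb := hbd x (w x) 0 (hnn x) (hdec x) le_rfl zero_le_one
    simp only [zero_mul, add_zero] at hb
    rw [Real.norm_eq_abs]
    exact hb
  · exact (hdec x).trans (mul_le_of_le_one_right hC (rpow_neg_le_one x (by norm_num)))

/-- **Gallay–Wayne 2005, §3.4 (first display) for NON-NEGATIVE vorticity: `H·T` is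
non-increasing — no positivity, log-tameness or log-Lipschitz hypothesis.** On a convex time set
`S`, let a classical planar solution have curl-free force, Biot–Savart velocity `u(s) = K₂ ∗ ω(s)`
and a vorticity with uniform rapid decay; fix `t₀ ∈ S` with `ω(t₀) ≥ 0` and `Γ = ∫ ω(t₀) > 0`, a
virtual time origin `t⋆ > 0`, `T(s) = s − t₀ + t⋆`, and the spreading Gaussian
`g_s = Γ (4πνT(s))⁻¹ e^{−‖x‖²/(4νT(s))}`. Then for `t₀ ≤ t` in `S`, with `H(s) = ∫ ω(s) log (ω(s)/g_s)`
(`0 log 0 = 0`): `H(t) · T(t) ≤ H(t₀) · t⋆`, i.e. `H(τ) ≤ H(0) e^{−τ}` under `T = t⋆e^{τ}`.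
(`ω(s) ≥ 0` for `s ≥ t₀` is the tree's minimum principle
`integral_abs_planarVorticity_eq_of_nonneg`.) Proof: the conclusion of
`IsClassicalNSSolutionOn.relEntropy_mul_le` is obtained for the regularised densities
`θ_ε = ω + ε ((1+‖x‖²)³)⁻¹`, which ARE positive and log-tame, up to an error
`O(ε log(1/ε))` (§4), and `ε → 0⁺` by dominated convergence (§5).
[cite: GallayWayne2005, Lemma 3.2 (p. 11) and §3.4 (p. 14, first display); BakryGentilLedoux2014, Prop. 6.2.5] -/
theorem IsClassicalNSSolutionOn.relEntropy_mul_le_of_nonneg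
    (h : IsClassicalNSSolutionOn S ν f u p) (hS : Convex ℝ S) (hν : 0 < ν)
    (hω : HasUniformRapidDecayOn S (fun t x => PlanarEigenmode.vorticity (u t) x))
    (hBS : ∀ s ∈ S, ∀ x, u s x = biotSavart2D (PlanarEigenmode.vorticity (u s)) x)
    (hcurl : ∀ s ∈ S, ∀ x, PlanarEigenmode.vorticity (f s) x = 0)
    {t₀ t tstar : ℝ} (ht₀ : t₀ ∈ S) (ht : t ∈ S) (hle : t₀ ≤ t) (htstar : 0 < tstar)
    (h0 : ∀ x, 0 ≤ PlanarEigenmode.vorticity (u t₀) x)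
    (hΓ : 0 < ∫ x, PlanarEigenmode.vorticity (u t₀) x) :
    (∫ x, PlanarEigenmode.vorticity (u t) x * Real.log (PlanarEigenmode.vorticity (u t) x /
        ((∫ y, PlanarEigenmode.vorticity (u t₀) y) / (4 * Real.pi * ν * (t - t₀ + tstar)) *
          Real.exp (-(‖x‖ ^ 2 / (4 * ν * (t - t₀ + tstar))))))) * (t - t₀ + tstar) ≤
      (∫ x, PlanarEigenmode.vorticity (u t₀) x * Real.log (PlanarEigenmode.vorticity (u t₀) x /
        ((∫ y, PlanarEigenmode.vorticity (u t₀) y) / (4 * Real.pi * ν * tstar) *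
          Real.exp (-(‖x‖ ^ 2 / (4 * ν * tstar)))))) * tstar := by
  -- `t = t₀`: nothing to prove
  rcases hle.eq_or_lt with heq | hlt
  · subst heq
    simp only [sub_self, zero_add, le_refl]
  have hU : UniqueDiffOn ℝ S := uniqueDiffOn_of_convex_of_lt' hS ht₀ ht hlt
  have hsm := PlanarEigenmode.isSmoothSpaceTimeOn_vorticity h.smooth_velocity hU
  obtain ⟨C, hC, hdec⟩ := exists_planarVorticity_decay₆ h.smooth_velocity hU hω
  set Γ : ℝ := ∫ y, PlanarEigenmode.vorticity (u t₀) y with hΓdef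
  have hTt : 0 < t - t₀ + tstar := by linarith
  -- conservation of the circulation on `S`
  have hΓs : ∀ s ∈ S, ∫ y, PlanarEigenmode.vorticity (u s) y = Γ := fun s hs =>
    (h.planarVorticity_moments_eq hS hω hBS hcurl ht₀ hs 0).1
  -- integrability and boundedness of every slice; `u(s)` bounded (Biot–Savart)
  have hwi : ∀ s ∈ S, Integrable (PlanarEigenmode.vorticity (u s))
      (volume : Measure (EuclideanSpace ℝ (Fin 2))) := fun s hs =>
    integrable_of_norm_le_rpow_neg (hsm.continuous_slice hs) (C := C) (r := 6)
      (by rw [finrank_two]; norm_num) fun x => by rw [Real.norm_eq_abs]; exact (hdec s hs x).1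
  have hwA : ∀ s ∈ S, ∀ x, |PlanarEigenmode.vorticity (u s) x| ≤ C := fun s hs x =>
    (hdec s hs x).1.trans (mul_le_of_le_one_right hC (rpow_neg_le_one x (by norm_num)))
  have hbddS : ∀ s ∈ S, ∃ M : ℝ, ∀ x, ‖u s x‖ ≤ M := fun s hs =>
    exists_norm_le_of_eq_biotSavart2D (hwi s hs) (hwA s hs) (hBS s hs)
  -- non-negativity for `s ≥ t₀` (minimum principle) and `‖ω(s)‖₁ = Γ`
  have hmp : ∀ s ∈ S, t₀ ≤ s → (∀ x, 0 ≤ PlanarEigenmode.vorticity (u s) x) ∧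
      ∫ x, |PlanarEigenmode.vorticity (u s) x| = Γ := fun s hs hts =>
    h.integral_abs_planarVorticity_eq_of_nonneg hS hν.le hcurl hω hbddS ht₀ h0 hs hts
  have hnn : ∀ s ∈ S, t₀ ≤ s → ∀ x, 0 ≤ PlanarEigenmode.vorticity (u s) x := fun s hs hts =>
    (hmp s hs hts).1
  -- the uniform velocity bound on `S ∩ [t₀, ∞)`
  set I₁ : ℝ := ∫ z, indicator (Metric.ball (0 : EuclideanSpace ℝ (Fin 2)) 1)
    (fun z => ‖z‖⁻¹) z with hI₁
  have hM : ∀ s ∈ S, t₀ ≤ s → s ≤ t → ∀ x, ‖u s x‖ ≤ (2 * Real.pi)⁻¹ * (C * I₁ + Γ) := by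
    intro s hs hts _ x
    have hb := norm_biotSavart2D_le (hwi s hs) (hwA s hs) x
    rw [(hmp s hs hts).2] at hb
    rw [hBS s hs x]
    exact hb
  -- the regularised inequality for every `0 < ε ≤ 1`, and the limit `ε → 0⁺`
  have hreg : ∀ ε ∈ Ioc (0 : ℝ) 1, _ := fun ε hε =>
    reg_relEntropy_mul_le h hS hν hω hBS hcurl ht₀ ht hlt htstar hnn hΓ hM hC hdec hε.1 hε.2
  have hlimL := (tendsto_reg_relEntropyRed (hsm.continuous_slice ht) (hnn t ht hlt.le) hC
    (fun x => (hdec t ht x).1) hΓ hν hTt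
    (∫ x : EuclideanSpace ℝ (Fin 2), ‖x‖ ^ 2 * (((1 : ℝ) + ‖x‖ ^ 2) ^ 3)⁻¹)
    (∫ x : EuclideanSpace ℝ (Fin 2), (((1 : ℝ) + ‖x‖ ^ 2) ^ 3)⁻¹)
    (∫ x, ‖x‖ ^ 2 * PlanarEigenmode.vorticity (u t) x)).mul_const (t - t₀ + tstar)
  have hlimR := ((tendsto_reg_relEntropyRed (hsm.continuous_slice ht₀) h0 hC
    (fun x => (hdec t₀ ht₀ x).1) hΓ hν htstar
    (∫ x : EuclideanSpace ℝ (Fin 2), ‖x‖ ^ 2 * (((1 : ℝ) + ‖x‖ ^ 2) ^ 3)⁻¹)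
    (∫ x : EuclideanSpace ℝ (Fin 2), (((1 : ℝ) + ‖x‖ ^ 2) ^ 3)⁻¹)
    (∫ x, ‖x‖ ^ 2 * PlanarEigenmode.vorticity (u t₀) x)).mul_const tstar).add
    (tendsto_eps_log_eps (Real.log (C + 1))
      ((6 * ((2 * Real.pi)⁻¹ * (C * I₁ + Γ)) + 60 * |ν|) *
        (8 * ∫ x : EuclideanSpace ℝ (Fin 2), (1 + ‖x‖) ^ (-(5 : ℝ))))
      (t - t₀ + tstar) (t - t₀))
  rw [add_zero] at hlimR
  have key := le_of_tendsto_of_tendsto hlimL hlimR (by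
    filter_upwards [Ioc_mem_nhdsGT zero_lt_one] with ε hε
    exact hreg ε hε)
  -- unfold `H` at `t` and `t₀`
  obtain ⟨-, hit, hi2t, hilogt, -⟩ := slice_nonneg h hC ht (fun x => (hdec t ht x).1) (hnn t ht hlt.le)
  obtain ⟨-, hi0, hi20, hilog0, -⟩ := slice_nonneg h hC ht₀ (fun x => (hdec t₀ ht₀ x).1) h0
  rw [(integral_mul_log_div_gaussian_eq_of_integrable hit hi2t hilogt hΓ hν hTt).2,
    (integral_mul_log_div_gaussian_eq_of_integrable hi0 hi20 hilog0 hΓ hν htstar).2, hΓs t ht,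
    mul_comm (Real.log _) Γ, mul_comm (Real.log _) Γ]
  exact key

/-- **Lemma 3.2 as printed, for NON-NEGATIVE vorticity: the relative entropy is non-increasing**,
`H(t) ≤ H(t₀)` for `t₀ ≤ t` in `S` (from `H·T ↓`, `H ≥ 0` by Gibbs' inequality, `t⋆ ≤ T`).
[cite: GallayWayne2005, Lemma 3.2 (p. 11)] -/
theorem IsClassicalNSSolutionOn.relEntropy_le_of_nonneg
    (h : IsClassicalNSSolutionOn S ν f u p) (hS : Convex ℝ S) (hν : 0 < ν)
    (hω : HasUniformRapidDecayOn S (fun t x => PlanarEigenmode.vorticity (u t) x))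
    (hBS : ∀ s ∈ S, ∀ x, u s x = biotSavart2D (PlanarEigenmode.vorticity (u s)) x)
    (hcurl : ∀ s ∈ S, ∀ x, PlanarEigenmode.vorticity (f s) x = 0)
    {t₀ t tstar : ℝ} (ht₀ : t₀ ∈ S) (ht : t ∈ S) (hle : t₀ ≤ t) (htstar : 0 < tstar)
    (h0 : ∀ x, 0 ≤ PlanarEigenmode.vorticity (u t₀) x)
    (hΓ : 0 < ∫ x, PlanarEigenmode.vorticity (u t₀) x) :
    ∫ x, PlanarEigenmode.vorticity (u t) x * Real.log (PlanarEigenmode.vorticity (u t) x /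
        ((∫ y, PlanarEigenmode.vorticity (u t₀) y) / (4 * Real.pi * ν * (t - t₀ + tstar)) *
          Real.exp (-(‖x‖ ^ 2 / (4 * ν * (t - t₀ + tstar)))))) ≤
      ∫ x, PlanarEigenmode.vorticity (u t₀) x * Real.log (PlanarEigenmode.vorticity (u t₀) x /
        ((∫ y, PlanarEigenmode.vorticity (u t₀) y) / (4 * Real.pi * ν * tstar) *
          Real.exp (-(‖x‖ ^ 2 / (4 * ν * tstar))))) := by
  rcases hle.eq_or_lt with heq | hlt
  · subst heq
    simp only [sub_self, zero_add, le_refl]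
  have hU : UniqueDiffOn ℝ S := uniqueDiffOn_of_convex_of_lt' hS ht₀ ht hlt
  have hsm := PlanarEigenmode.isSmoothSpaceTimeOn_vorticity h.smooth_velocity hU
  have hmain := h.relEntropy_mul_le_of_nonneg hS hν hω hBS hcurl ht₀ ht hle htstar h0 hΓ
  obtain ⟨C, hC, hdec⟩ := exists_planarVorticity_decay₆ h.smooth_velocity hU hω
  set Γ : ℝ := ∫ y, PlanarEigenmode.vorticity (u t₀) y with hΓdef
  have hTt : 0 < t - t₀ + tstar := by linarith
  have hΓt : ∫ y, PlanarEigenmode.vorticity (u t) y = Γ :=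
    (h.planarVorticity_moments_eq hS hω hBS hcurl ht₀ ht 0).1
  -- non-negativity at `t`
  have hwi : ∀ s ∈ S, Integrable (PlanarEigenmode.vorticity (u s))
      (volume : Measure (EuclideanSpace ℝ (Fin 2))) := fun s hs =>
    integrable_of_norm_le_rpow_neg (hsm.continuous_slice hs) (C := C) (r := 6)
      (by rw [finrank_two]; norm_num) fun x => by rw [Real.norm_eq_abs]; exact (hdec s hs x).1
  have hwA : ∀ s ∈ S, ∀ x, |PlanarEigenmode.vorticity (u s) x| ≤ C := fun s hs x =>
    (hdec s hs x).1.trans (mul_le_of_le_one_right hC (rpow_neg_le_one x (by norm_num)))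
  have hbddS : ∀ s ∈ S, ∃ M : ℝ, ∀ x, ‖u s x‖ ≤ M := fun s hs =>
    exists_norm_le_of_eq_biotSavart2D (hwi s hs) (hwA s hs) (hBS s hs)
  have hnnt : ∀ x, 0 ≤ PlanarEigenmode.vorticity (u t) x :=
    (h.integral_abs_planarVorticity_eq_of_nonneg hS hν.le hcurl hω hbddS ht₀ h0 ht hlt.le).1
  obtain ⟨-, hit, hi2t, hilogt, -⟩ := slice_nonneg h hC ht (fun x => (hdec t ht x).1) hnnt
  obtain ⟨hgpos, hgi, hgint, -⟩ := gaussian_facts' hΓ hν hTt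
  -- `H(t) ≥ 0` (Gibbs)
  have hH0 : 0 ≤ ∫ x, PlanarEigenmode.vorticity (u t) x * Real.log (PlanarEigenmode.vorticity (u t) x /
      (Γ / (4 * Real.pi * ν * (t - t₀ + tstar)) * Real.exp (-(‖x‖ ^ 2 / (4 * ν * (t - t₀ + tstar)))))) :=
    Literature.Analysis.FunctionSpaces.integral_mul_log_div_nonneg hnnt hgpos hit hgi
      (integral_mul_log_div_gaussian_eq_of_integrable hit hi2t hilogt hΓ hν hTt).1 (by rw [hΓt, hgint])
  have htT : tstar ≤ t - t₀ + tstar := by linarith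
  nlinarith [hmain, hH0, htT]

/-- **Gallay–Wayne 2005, §3.4 (second display) for NON-NEGATIVE vorticity — explicit `L¹`
convergence to the Oseen vortex, CO-SIGNEDNESS ONLY.** In the setting of
`relEntropy_mul_le_of_nonneg` (classical planar solution on a convex time set, curl-free force,
`u = K₂ ∗ ω`, uniform rapid decay; `ω(t₀) ≥ 0`, `Γ = ∫ ω(t₀) > 0`; `t₀ ≤ t` in `S`, `t⋆ > 0`,
`T(t) = t − t₀ + t⋆`, `g_t = Γ(4πνT)⁻¹e^{−‖x‖²/(4νT)}`):
`∫ |ω(t) − g_t| ≤ √(2 Γ H(t₀) t⋆ / T(t))`, `H(t₀) = ∫ ω(t₀) log(ω(t₀)/g_{t₀})` — under `T = t⋆ e^{τ}`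
this is "`‖w(τ) − αG‖_{L¹} ≤ √(2α) (H(w₀) − H(αG))^{1/2} e^{−τ/2}`". Proof as printed:
`relEntropy_mul_le_of_nonneg` and the Csiszár–Kullback–Pinsker inequality
(`Literature.Analysis.FunctionSpaces.integral_abs_sub_le_sqrt`).
[cite: GallayWayne2005, §3.4 (p. 14, second display); BoucheronLugosiMassart2013, Thm. 4.19] -/
theorem IsClassicalNSSolutionOn.integral_abs_planarVorticity_sub_gaussian_le_of_nonneg
    (h : IsClassicalNSSolutionOn S ν f u p) (hS : Convex ℝ S) (hν : 0 < ν)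
    (hω : HasUniformRapidDecayOn S (fun t x => PlanarEigenmode.vorticity (u t) x))
    (hBS : ∀ s ∈ S, ∀ x, u s x = biotSavart2D (PlanarEigenmode.vorticity (u s)) x)
    (hcurl : ∀ s ∈ S, ∀ x, PlanarEigenmode.vorticity (f s) x = 0)
    {t₀ t tstar : ℝ} (ht₀ : t₀ ∈ S) (ht : t ∈ S) (hle : t₀ ≤ t) (htstar : 0 < tstar)
    (h0 : ∀ x, 0 ≤ PlanarEigenmode.vorticity (u t₀) x)
    (hΓ : 0 < ∫ x, PlanarEigenmode.vorticity (u t₀) x) :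
    ∫ x, |PlanarEigenmode.vorticity (u t) x -
        (∫ y, PlanarEigenmode.vorticity (u t₀) y) / (4 * Real.pi * ν * (t - t₀ + tstar)) *
          Real.exp (-(‖x‖ ^ 2 / (4 * ν * (t - t₀ + tstar))))| ≤
      Real.sqrt (2 * (∫ y, PlanarEigenmode.vorticity (u t₀) y) *
        (∫ x, PlanarEigenmode.vorticity (u t₀) x * Real.log (PlanarEigenmode.vorticity (u t₀) x /
          ((∫ y, PlanarEigenmode.vorticity (u t₀) y) / (4 * Real.pi * ν * tstar) *
            Real.exp (-(‖x‖ ^ 2 / (4 * ν * tstar)))))) * tstar / (t - t₀ + tstar)) := by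
  have hmain := h.relEntropy_mul_le_of_nonneg hS hν hω hBS hcurl ht₀ ht hle htstar h0 hΓ
  set Γ : ℝ := ∫ y, PlanarEigenmode.vorticity (u t₀) y with hΓdef
  have hTt : 0 < t - t₀ + tstar := by linarith
  have hΓt : ∫ y, PlanarEigenmode.vorticity (u t) y = Γ :=
    (h.planarVorticity_moments_eq hS hω hBS hcurl ht₀ ht 0).1
  -- the decay constant at weight `6` (no unique differentiability needed) and the slices
  obtain ⟨C, hC, hdec0⟩ := hω.norm_le_rpow 6
  have hdec : ∀ s ∈ S, ∀ x, |PlanarEigenmode.vorticity (u s) x| ≤ C * (1 + ‖x‖) ^ (-(6 : ℝ)) := by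
    intro s hs x
    have h1 := hdec0 s hs x
    rw [Real.norm_eq_abs] at h1
    exact h1.trans (by norm_num)
  have hwi : ∀ s ∈ S, Integrable (PlanarEigenmode.vorticity (u s))
      (volume : Measure (EuclideanSpace ℝ (Fin 2))) := fun s hs =>
    integrable_of_norm_le_rpow_neg (contDiff_planarVorticity_slice' h hs).continuous (C := C) (r := 6)
      (by rw [finrank_two]; norm_num) fun x => by rw [Real.norm_eq_abs]; exact hdec s hs x
  have hwA : ∀ s ∈ S, ∀ x, |PlanarEigenmode.vorticity (u s) x| ≤ C := fun s hs x =>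
    (hdec s hs x).trans (mul_le_of_le_one_right hC (rpow_neg_le_one x (by norm_num)))
  have hbddS : ∀ s ∈ S, ∃ M : ℝ, ∀ x, ‖u s x‖ ≤ M := fun s hs =>
    exists_norm_le_of_eq_biotSavart2D (hwi s hs) (hwA s hs) (hBS s hs)
  have hnnt : ∀ x, 0 ≤ PlanarEigenmode.vorticity (u t) x :=
    (h.integral_abs_planarVorticity_eq_of_nonneg hS hν.le hcurl hω hbddS ht₀ h0 ht hle).1
  obtain ⟨-, hit, hi2t, hilogt, -⟩ := slice_nonneg h hC ht (hdec t ht) hnnt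
  obtain ⟨hgpos, hgi, hgint, -⟩ := gaussian_facts' hΓ hν hTt
  have hP := Literature.Analysis.FunctionSpaces.integral_abs_sub_le_sqrt hnnt hgpos hit hgi
    (integral_mul_log_div_gaussian_eq_of_integrable hit hi2t hilogt hΓ hν hTt).1 (by rw [hΓt, hgint])
  rw [hgint] at hP
  refine hP.trans (Real.sqrt_le_sqrt ?_)
  rw [le_div_iff₀ hTt]
  have h2 := mul_le_mul_of_nonneg_left hmain (by positivity : (0 : ℝ) ≤ 2 * Γ)
  linarith [h2]

end Main

end Literature.Analysis.FluidPDE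

end
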